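import Literature.Computability.Cryptography.WordRAMSubrun
import Literature.Computability.Cryptography.WordRAMAchieves
import Literature.Computability.FineGrained.CliqueETHPositionGraph
import HarnessLib

/-!
# ETH-hardness of `k`-Clique: the word-RAM program of the grouping reduction

The program behind the named fact `sparseKSATInRAMTime_of_kCliqueInTimeNLittleOK` of
`…FineGrained.CliqueETH` (Chen–Huang–Kanj–Xia, JCSS 72 (2006), Lemma 2.2 / Thm. 5.5: an
`f(k) · N^{o(k)}` clique algorithm decides sparse 3-SAT in time `2^{δ n}`), written as structured
word-RAM code (`SProg` of `…WordRAMStructured`, verified in the logic `SProg.Achieves` of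
`…WordRAMAchieves`) around one emulated run of the hypothetical clique program
(`SProg.withSubrun` of `…WordRAMSubrun`), and the proof that its *build* phase computes, in closed
form, the memory presenting the `kClique` encoding of the position instance
(`posInstance` of `…CliqueETHPositionGraph`) to the emulator. The run, the word-size and time
analysis, and the proof of the named fact are in `…CliqueETHGroupingReduction`.

* **The program** (`CliqueRed.pre K kM cM`, `CliqueRed.post`, `CliqueRed.reduction`): relocate the
  input (`SProg.relocate`); compute the constants `m, b = ⌈m/K⌉, 3b, S = 2^{3b}, N = K S` and the
  bases of the tables (`setup1`), the emulated word size `ws = kM · size (N² + 2)` by a halving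
  loop (`sizeLoop`) and the emulator's environment registers (`setup3`); fill the slot-variable
  and slot-polarity tables by one pass over the encoded clauses (`tables`); the vertex table
  `OK[a] = ¬ conflictB (a, a) ∧ goodB a` (`okTable`, with the subroutines `conf` and `good`
  computing `conflictB` and `goodB` of `…CliqueETHPositionGraph` slot by slot, disjunctions of bits
  being computed with the overflow-free `eq`/`band`/`lt` only); the adjacency matrix of the
  position instance, reduced modulo `2^ws`, in the emulated cells (`matrix`); the header
  `N² + 2, K, N` (`header`); clear the scratch registers (`clearRegs`); after the emulated run,
  `post` copies the clique program's answer bit to the output.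
* **Ghost parameters** (`CliqueRed.Params` with `x, Lx, X, m, b, B3, S, N, V0, P0, OK0, Bv, ws, Pw,
  V, Sv, env`), the word-size requirement `Params.Fits W`, and the intended memory contents stage by
  stage (`varTab`, `polTab`, `okVal`, `adjVal`, `ycell`; `tabData`, `okData`, `matData`,
  `finData`, `finMem`).
* **Verification**, phase by phase, by symbolic execution of straight-line blocks (`simp` over
  `execOps` on memories split as `merge registers data`, overflow side conditions discharged by
  `omega`) and the counted while rule: `setup1_spec`, `sizeLoop_spec`, `setup3_spec`, `tables_spec`,
  `conf_spec`, `good_spec`, `okTable_spec`, `matrix_spec`, and finally **`Params.pre_spec`**: on the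
  initial memory of `x = encodeCNFWords φ` (word size `W` with `Fits W`, `K ≥ 2`, width `≤ 3`) the
  build ends within `Params.Tpre` steps in exactly the memory `Params.finMem`.

## References

* J. Chen, X. Huang, I. A. Kanj, G. Xia, *Strong computational lower bounds via parameterized
  complexity*, JCSS 72 (2006) 1346–1367, Lemma 2.2 (the grouping technique) and Thm. 5.5.
* V. Vassilevska Williams, *On some fine-grained questions in algorithms and complexity*,
  Proc. ICM 2018, §2 (the word RAM; algorithms calling an algorithm for another problem).
* T. Nipkow, G. Klein, *Concrete Semantics with Isabelle/HOL*, Springer 2014, §12 (verification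
  of `WHILE` programs by invariants).
-/


namespace Literature.Computability.FineGrained

open Cryptography Cryptography.WordRAM Complexity Cryptography.WordRAM.SProg

namespace CliqueRed

/-! ### Operand shorthands -/

/-- Direct operand: register / cell `i`. [folklore] -/
abbrev r (i : ℕ) : Operand := .dir i
/-- Indirect operand through cell `i`. [folklore] -/
abbrev pt (i : ℕ) : Operand := .ind i
/-- Immediate operand. [folklore] -/
abbrev im (c : ℕ) : Operand := .imm c

/-! ### Register map

`0 = X` (base of the relocated input, `x[j]` in cell `X + j`), `1 = D = X - 1` (set by `relocate`);
`2 = m`, `3 = b`, `4 = 3b`, `5 = S = 2^{3b}`, `6 = N = K S`, `7 = V₀` (slot-variable table),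
`8 = P₀` (slot-polarity table), `9 = OK₀` (vertex table); the emulator's layout
`10 = Bv`, `11 = Sv`, `12 = Gv (= 0)`, `13 = Pw = 2^ws`, temporaries `14, 15, 16`; `17` post;
scratch `20–27` (setup, tables), `30–45` (`conf`), `46–56` (`good`), `60–66` (vertex loops). -/

/-- The emulator layout used by the reduction. [folklore] -/
def lay : Layout := ⟨10, 11, 12, 13, 14, 15, 16⟩

/-! ### Setup: the constants -/

/-- Setup, part 1: `m, b, 3b, S, N, V₀, P₀, OK₀, Bv`, then `r21 := N² + 2`,
`r22 := 0`. [folklore] -/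
def setup1 (K : ℕ) : SProg := block [
  (.add, r 20, r 0, im 1), (.band, r 2, pt 20, pt 20),
  (.add, r 3, r 2, im (K - 1)), (.div, r 3, r 3, im K),
  (.mul, r 4, r 3, im 3),
  (.shl, r 5, im 1, r 4),
  (.mul, r 6, im K, r 5),
  (.sub, r 20, r 1, im 100), (.add, r 7, r 1, r 20), (.add, r 7, r 7, im 1),
  (.mul, r 20, r 4, im K), (.add, r 8, r 7, r 20), (.add, r 9, r 8, r 20), (.add, r 10, r 9, r 6),
  (.mul, r 21, r 6, r 6), (.add, r 21, r 21, im 2), (.band, r 22, im 0, im 0)]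

/-- Setup, part 2: `r22 := Nat.size (N² + 2)` by halving. [folklore] -/
def sizeLoop : SProg :=
  whilenz (r 21) (block [(.shr, r 21, r 21, im 1), (.add, r 22, r 22, im 1)])

/-- Setup, part 3: `ws := kM · size`, `Pw := 2^ws`, and `r23 := max (Pw - 1) (max cM (N² + 2))`
(`cM` the largest constant of the clique program), `Sv := Bv + r23 + 1`, `Gv := 0`. [folklore] -/
def setup3 (kM cM : ℕ) : SProg := seqs [
  block [(.mul, r 22, r 22, im kM), (.shl, r 13, im 1, r 22), (.sub, r 23, r 13, im 1),
    (.lt, r 24, r 23, im cM)],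
  ifz (r 24) skip (block [(.band, r 23, im cM, im cM)]),
  block [(.mul, r 25, r 6, r 6), (.add, r 25, r 25, im 2), (.lt, r 24, r 23, r 25)],
  ifz (r 24) skip (block [(.band, r 23, r 25, r 25)]),
  block [(.add, r 11, r 10, r 23), (.add, r 11, r 11, im 1), (.band, r 12, im 0, im 0)]]

/-! ### The slot tables -/

/-- Tables, one literal: `VAR[3q + l] := var + 1`, `POL[3q + l] := polarity`; advance. [folklore] -/
def tabLit : SProg := block [
  (.band, r 25, pt 20, pt 20),
  (.add, r 26, r 7, r 21), (.add, r 26, r 26, r 24),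
  (.shr, r 27, r 25, im 1), (.add, r 27, r 27, im 1), (.band, pt 26, r 27, r 27),
  (.add, r 26, r 8, r 21), (.add, r 26, r 26, r 24),
  (.band, r 27, r 25, im 1), (.band, pt 26, r 27, r 27),
  (.add, r 20, r 20, im 1), (.add, r 24, r 24, im 1), (.sub, r 23, r 23, im 1)]

/-- Tables, one clause: read its length, process its literals, advance `3q`. [folklore] -/
def tabClause : SProg := seqs [
  block [(.band, r 23, pt 20, pt 20), (.add, r 20, r 20, im 1), (.band, r 24, im 0, im 0)],
  whilenz (r 23) tabLit,
  block [(.add, r 21, r 21, im 3), (.sub, r 22, r 22, im 1)]]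

/-- The slot tables: one sequential pass over the encoded clauses. [folklore] -/
def tables : SProg := seqs [
  block [(.add, r 20, r 0, im 2), (.band, r 21, im 0, im 0), (.band, r 22, r 2, r 2)],
  whilenz (r 22) tabClause]

/-! ### The conflict and goodness subroutines -/

/-- `conf`, inner body: slot `t = r35` of `(i, μ) = (r30, r31)` against slot `u = r37` of
`(j, ν) = (r32, r33)`, OR-ed into `r34` (disjunction of bits `a`, `b` as `[[a = 0] ∧ [b = 0] < 1]`,
using only the overflow-free operations `eq`, `band`, `lt`). [folklore] -/
def confBody : SProg := block [
  (.mul, r 39, r 30, r 4), (.add, r 39, r 39, r 35), (.add, r 39, r 7, r 39), (.band, r 39,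
  pt 39, pt 39),
  (.mul, r 40, r 32, r 4), (.add, r 40, r 40, r 37), (.add, r 40, r 7, r 40), (.band, r 40,
  pt 40, pt 40),
  (.shr, r 41, r 31, r 35), (.band, r 41, r 41, im 1),
  (.shr, r 42, r 33, r 37), (.band, r 42, r 42, im 1),
  (.lt, r 43, im 0, r 39), (.eq, r 44, r 39, r 40), (.eq, r 45, r 41, r 42), (.lt, r 45, r 45,
  im 1),
  (.band, r 43, r 43, r 44), (.band, r 43, r 43, r 45),
  (.eq, r 44, r 34, im 0), (.eq, r 45, r 43, im 0), (.band, r 44, r 44, r 45), (.lt, r 34, r 44,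
  im 1),
  (.add, r 37, r 37, im 1), (.sub, r 38, r 38, im 1)]

/-- `conf`, one row: all slots `u` against slot `t`. [folklore] -/
def confRow : SProg := seqs [
  block [(.band, r 37, im 0, im 0), (.band, r 38, r 4, r 4)],
  whilenz (r 38) confBody,
  block [(.add, r 35, r 35, im 1), (.sub, r 36, r 36, im 1)]]

/-- `conf`: `r34 := conflictB (r30, r31, r32, r33)`. [folklore] -/
def conf : SProg := seqs [
  block [(.band, r 34, im 0, im 0), (.band, r 35, im 0, im 0), (.band, r 36, r 4, r 4)],
  whilenz (r 36) confRow]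

/-- `good`, one slot `3q' + l` of clause `q'` (= `r47`) of block `i`: OR into `r50` the bit
"the slot carries a literal whose polarity is the mask's bit". [folklore] -/
def goodSlot (l : ℕ) : List OpSpec := [
  (.mul, r 51, r 47, im 3), (.add, r 51, r 51, im l),
  (.mul, r 52, r 30, r 4), (.add, r 52, r 52, r 51),
  (.add, r 53, r 7, r 52), (.band, r 53, pt 53, pt 53),
  (.add, r 54, r 8, r 52), (.band, r 54, pt 54, pt 54),
  (.shr, r 55, r 31, r 51), (.band, r 55, r 55, im 1),
  (.lt, r 53, im 0, r 53), (.eq, r 54, r 54, r 55), (.band, r 53, r 53, r 54),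
  (.eq, r 54, r 50, im 0), (.eq, r 55, r 53, im 0), (.band, r 54, r 54, r 55), (.lt, r 50, r 54,
  im 1)]

/-- `good`, one clause `q' = r47` of block `i = r30`: AND into `r46` the bit "clause `i b + q'` is
absent or satisfied by the mask `r31`" (five short blocks, to keep symbolic execution cheap).
[folklore] -/
def goodBody : SProg := seqs [
  block [(.mul, r 49, r 30, r 3), (.add, r 49, r 49, r 47), (.lt, r 49, r 49, r 2),
    (.lt, r 49, r 49, im 1), (.band, r 50, im 0, im 0)],
  block (goodSlot 0), block (goodSlot 1), block (goodSlot 2),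
  block [(.eq, r 51, r 49, im 0), (.eq, r 52, r 50, im 0), (.band, r 51, r 51, r 52),
    (.lt, r 49, r 51, im 1), (.band, r 46, r 46, r 49), (.add, r 47, r 47, im 1),
    (.sub, r 48, r 48, im 1)]]

/-- `good`: `r46 := goodB (r30, r31)`. [folklore] -/
def good : SProg := seqs [
  block [(.band, r 46, im 1, im 1), (.band, r 47, im 0, im 0), (.band, r 48, r 3, r 3)],
  whilenz (r 48) goodBody]

/-! ### The vertex table and the adjacency matrix -/

/-- Vertex table, one vertex `a = r60`: `OK[a] := ¬ conflictB (a, a) ∧ goodB a`. [folklore] -/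
def okBody : SProg := seqs [
  block [(.div, r 30, r 60, r 5), (.mod, r 31, r 60, r 5), (.band, r 32, r 30, r 30),
    (.band, r 33, r 31, r 31)],
  conf,
  block [(.lt, r 62, r 34, im 1)],
  good,
  block [(.band, r 62, r 62, r 46), (.add, r 56, r 9, r 60), (.band, pt 56, r 62, r 62),
    (.add, r 60, r 60, im 1), (.sub, r 61, r 61, im 1)]]

/-- The vertex table `OK[a]`, `a < N`. [folklore] -/
def okTable : SProg := seqs [
  block [(.band, r 60, im 0, im 0), (.band, r 61, r 6, r 6)],
  whilenz (r 61) okBody]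

/-- Adjacency matrix, one entry `(a, a') = (r60, r63)`: the bit `adjB a a'`, reduced modulo `Pw`,
into emulated cell `3 + a N + a'`. [folklore] -/
def matEntry : SProg := seqs [
  block [(.div, r 30, r 60, r 5), (.mod, r 31, r 60, r 5), (.div, r 32, r 63, r 5),
    (.mod, r 33, r 63, r 5)],
  conf,
  block [(.lt, r 65, r 34, im 1),
    (.eq, r 66, r 30, r 32), (.lt, r 66, r 66, im 1), (.band, r 65, r 65, r 66),
    (.add, r 66, r 9, r 60), (.band, r 66, pt 66, pt 66), (.band, r 65, r 65, r 66),
    (.add, r 66, r 9, r 63), (.band, r 66, pt 66, pt 66), (.band, r 65, r 65, r 66),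
    (.mod, r 65, r 65, r 13),
    (.mul, r 66, r 60, r 6), (.add, r 66, r 66, r 63), (.add, r 66, r 66, im 3),
    (.add, r 66, r 10, r 66), (.band, pt 66, r 65, r 65),
    (.add, r 63, r 63, im 1), (.sub, r 64, r 64, im 1)]]

/-- Adjacency matrix, one row `a = r60`. [folklore] -/
def matRow : SProg := seqs [
  block [(.band, r 63, im 0, im 0), (.band, r 64, r 6, r 6)],
  whilenz (r 64) matEntry,
  block [(.add, r 60, r 60, im 1), (.sub, r 61, r 61, im 1)]]

/-- The adjacency matrix of the position instance, in the emulated memory. [folklore] -/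
def matrix : SProg := seqs [
  block [(.band, r 60, im 0, im 0), (.band, r 61, r 6, r 6)],
  whilenz (r 61) matRow]

/-! ### Header, register clearing, read-out -/

/-- The header of the emulated input: cells `0, 1, 2` hold `N² + 2`, `K`, `N` (mod `Pw`).
[folklore] -/
def header (K : ℕ) : SProg := block [
  (.mul, r 20, r 6, r 6), (.add, r 20, r 20, im 2), (.mod, r 20, r 20, r 13),
  (.band, pt 10, r 20, r 20),
  (.band, r 20, im K, im K), (.mod, r 20, r 20, r 13), (.add, r 21, r 10, im 1),
  (.band, pt 21, r 20, r 20),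
  (.mod, r 20, r 6, r 13), (.add, r 21, r 10, im 2), (.band, pt 21, r 20, r 20)]

/-- The registers cleared at the end of the build: all cells `< 100` except the four environment
registers `10–13`. [folklore] -/
def clearedRegs : List ℕ :=
  (List.range 100).filter fun i => ¬ (10 ≤ i ∧ i ≤ 13)

/-- Clear the scratch registers (so that the final memory of the build is a closed-form function).
[folklore] -/
def clearRegs : SProg := block (clearedRegs.map fun i => (.band, r i, im 0, im 0))

/-- **The build**: relocate the input, compute the constants, the slot tables, the vertex table,
the adjacency matrix and the header of the emulated `kClique` input, clear the scratch.
(`K` groups; `kM`, `cM`: word-size constant and largest constant of the clique program.)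
[folklore] -/
def pre (K kM cM : ℕ) : SProg := seqs [
  relocate, setup1 K, sizeLoop, setup3 kM cM, tables, okTable, matrix, header K, clearRegs]

/-- **The read-out**: output the emulated cell `1` (the clique program's answer bit). [folklore] -/
def post : SProg := block [(.add, r 17, r 10, im 1), (.band, r 1, pt 17, pt 17), (.band, r 0,
im 1, im 1)]

/-- **The reduction program**: sparse 3-SAT by one emulated run of the clique program `M`.
[folklore] -/
def reduction (M : Program) (K kM : ℕ) : Program :=
  withSubrun (pre K kM M.maxConst) lay M post

/-- The build is query-free. [folklore] -/
theorem pre_queryFree (K kM cM : ℕ) : (pre K kM cM).QueryFree := by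
  refine seqs_queryFree ?_
  simp only [List.mem_cons, List.not_mem_nil, or_false]
  rintro s (rfl | rfl | rfl | rfl | rfl | rfl | rfl | rfl | rfl)
  · exact relocate_queryFree
  · exact block_queryFree _
  · exact block_queryFree _
  · refine seqs_queryFree ?_
    simp only [List.mem_cons, List.not_mem_nil, or_false]
    rintro s (rfl | rfl | rfl | rfl | rfl)
    · exact block_queryFree _
    · exact ⟨trivial, block_queryFree _⟩
    · exact block_queryFree _
    · exact ⟨trivial, block_queryFree _⟩
    · exact block_queryFree _
  · simp [tables, tabClause, tabLit, seqs, QueryFree, block_queryFree]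
  · simp [okTable, okBody, conf, confRow, confBody, good, goodBody, seqs, QueryFree,
    block_queryFree]
  · simp [matrix, matRow, matEntry, conf, confRow, confBody, seqs, QueryFree, block_queryFree]
  · exact block_queryFree _
  · exact block_queryFree _

/-- The read-out is query-free. [folklore] -/
theorem post_queryFree : post.QueryFree := block_queryFree _

/-- The reduction program is deterministic. [folklore] -/
theorem reduction_isDeterministic (M : Program) (K kM : ℕ) : (reduction M K kM).IsDeterministic :=
  withSubrun_isDeterministic _ _ _ _

/-- The reduction program is oracle-free. [folklore] -/
theorem reduction_isOracleFree (M : Program) (K kM : ℕ) : (reduction M K kM).IsOracleFree :=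
  withSubrun_isOracleFree (pre_queryFree _ _ _) post_queryFree _ _

end CliqueRed

end Literature.Computability.FineGrained

namespace Literature.Computability.FineGrained

open Cryptography Cryptography.WordRAM Complexity Cryptography.WordRAM.SProg

namespace CliqueRed

/-! ### Ghost parameters of a run -/

/-- The data of a run of the reduction: the formula, the number of groups `K`, and the word-size
constant `kM` and largest constant `cM` of the clique program. [folklore] -/
structure Params where
  /-- The input formula. -/
  φ : CNF ℕ
  /-- The number of groups (= the clique size sought). -/
  K : ℕ
  /-- The word-size constant of the clique program. -/
  kM : ℕ
  /-- The largest constant of the clique program. -/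
  cM : ℕ

namespace Params

variable (g : Params)

/-- The input words. [folklore] -/
def x : List ℕ := encodeCNFWords g.φ
/-- The input length `Lx`. [folklore] -/
def Lx : ℕ := g.x.length
/-- The base `X` of the relocated input: `x[j]` sits in cell `X + j`. [folklore] -/
def X : ℕ := g.Lx + 101
/-- The number of clauses. [folklore] -/
def m : ℕ := g.φ.length
/-- The block length `b = ⌈m / K⌉`. [folklore] -/
def b : ℕ := blockLen g.m g.K
/-- Slots per block, `3b`. [folklore] -/
def B3 : ℕ := 3 * g.b
/-- Masks per block, `S = 2^{3b}`. [folklore] -/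
def S : ℕ := 2 ^ g.B3
/-- The number of vertices `N = K S`. [folklore] -/
def N : ℕ := g.K * g.S
/-- Base of the slot-variable table. [folklore] -/
def V0 : ℕ := g.X + g.Lx
/-- Base of the slot-polarity table. [folklore] -/
def P0 : ℕ := g.V0 + g.B3 * g.K
/-- Base of the vertex table. [folklore] -/
def OK0 : ℕ := g.P0 + g.B3 * g.K
/-- Base of the emulated cells. [folklore] -/
def Bv : ℕ := g.OK0 + g.N
/-- The emulated word size `ws = kM · size (N² + 2)`. [folklore] -/
def ws : ℕ := g.kM * Nat.size (g.N * g.N + 2)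
/-- The emulated modulus `Pw = 2^ws`. [folklore] -/
def Pw : ℕ := 2 ^ g.ws
/-- The value bound `V = max (Pw - 1) (max cM (N² + 2))` of the emulation. [folklore] -/
def V : ℕ := max (g.Pw - 1) (max g.cM (g.N * g.N + 2))
/-- Base of the stamps. [folklore] -/
def Sv : ℕ := g.Bv + g.V + 1
/-- The emulator environment: cells at `Bv`, stamps at `Sv`, generation `0`, word size `ws`,
region size `V + 1`. [folklore] -/
def env : Env := ⟨g.Bv, g.Sv, 0, g.ws, g.V + 1⟩

/-- The chain of bases. [folklore] -/
theorem bases : 100 < g.X ∧ g.X + g.Lx = g.V0 ∧ g.V0 + g.B3 * g.K = g.P0 ∧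
    g.P0 + g.B3 * g.K = g.OK0 ∧ g.OK0 + g.N = g.Bv ∧ g.Bv + g.V + 1 = g.Sv := by
  refine ⟨by unfold X; omega, rfl, rfl, rfl, rfl, rfl⟩

/-- `2 ≤ Lx`: the encoding starts with `numVars, numClauses`. [folklore] -/
theorem two_le_Lx : 2 ≤ g.Lx := by
  unfold Lx x; rw [length_encodeCNFWords_eq]; omega

/-- `1 ≤ S`. [folklore] -/
theorem one_le_S : 1 ≤ g.S := Nat.one_le_two_pow

/-- `K ≤ N`. [folklore] -/
theorem K_le_N : g.K ≤ g.N := Nat.le_mul_of_pos_right _ g.one_le_S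

/-- `N² + 2 ≤ V`, `cM ≤ V`, `Pw - 1 ≤ V`. [folklore] -/
theorem le_V : g.N * g.N + 2 ≤ g.V ∧ g.cM ≤ g.V ∧ g.Pw - 1 ≤ g.V :=
  ⟨le_max_of_le_right (le_max_right _ _), le_max_of_le_right (le_max_left _ _), le_max_left _ _⟩

/-- `m ≤ b K` for `0 < K`. [folklore] -/
theorem m_le (hK : 0 < g.K) : g.m ≤ g.b * g.K := le_blockLen_mul hK

/-- The vertex number is that of the position instance. [folklore] -/
theorem N_eq : g.N = (posInstance g.φ g.K).n := rfl

/-- **Word-size requirements** of a run at word size `W`: the stamps fit (`Sv + V + 1 ≤ 2 ^ W`,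
whence every address and every table value fits), the emulated word size is below `W`, and the
input width is at most `W` (so the input is stored exactly). [folklore] -/
structure Fits (W : ℕ) : Prop where
  top : g.Sv + g.V + 1 ≤ 2 ^ W
  ws_lt : g.ws < W
  width : inputWidth g.x ≤ W

/-- Under `Fits`, the input words fit. [folklore] -/
theorem Fits.input {g : Params} {W : ℕ} (h : g.Fits W) : ∀ v ∈ g.x, v < 2 ^ W := fun v hv =>
  lt_of_lt_of_le (lt_two_pow_inputWidth_of_mem g.x v hv) (Nat.pow_le_pow_right Nat.two_pos h.width)

/-- Consequences of `Fits`: the frequently used bounds, linear in the bases. [folklore] -/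
theorem Fits.bounds {W : ℕ} (h : g.Fits W) :
    g.Sv + g.V + 1 ≤ 2 ^ W ∧ g.N * g.N + 2 ≤ g.V ∧ g.Pw ≤ g.V + 1 ∧ g.cM ≤ g.V ∧
      2 * g.Lx + 102 < 2 ^ W := by
  have h1 := h.top
  have h2 := g.le_V
  have h3 := g.bases
  have h4 := g.two_le_Lx
  refine ⟨h1, h2.1, by omega, h2.2.1, ?_⟩
  unfold Sv Bv OK0 P0 V0 X at h1
  omega

end Params

/-! ### Literals by position, and the table values -/

/-- Literal `l` of clause `q` of `φ`, if any. [folklore] -/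
def litAt (φ : CNF ℕ) (q l : ℕ) : Option (Literal ℕ) :=
  (φ[q]?).bind fun cl : Clause ℕ => cl[l]?

/-- Slots are literals by position: slot `t` of block `i` is literal `t % 3` of clause
`i b + t / 3`. [folklore] -/
theorem slotLit_eq_litAt (φ : CNF ℕ) (b i t : ℕ) :
    slotLit φ b i t = litAt φ (i * b + t / 3) (t % 3) := rfl

/-- The global slot `3 (i b) + t` of block `i`, slot `t`: clause and position. [folklore] -/
theorem litAt_slot (φ : CNF ℕ) (b i t : ℕ) :
    litAt φ ((3 * (i * b) + t) / 3) ((3 * (i * b) + t) % 3) = slotLit φ b i t := by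
  rw [slotLit_eq_litAt, Nat.mul_add_div (by norm_num), Nat.mul_add_mod]

/-- The slot-variable table: `var + 1` for an existing literal, `0` otherwise. [folklore] -/
def varTab (φ : CNF ℕ) (s : ℕ) : ℕ :=
  match litAt φ (s / 3) (s % 3) with
  | some l => l.1 + 1
  | none => 0

/-- The slot-polarity table: the polarity bit of an existing literal, `0` otherwise. [folklore] -/
def polTab (φ : CNF ℕ) (s : ℕ) : ℕ :=
  match litAt φ (s / 3) (s % 3) with
  | some l => l.2.toNat
  | none => 0

/-- `litAt` past the last clause. [folklore] -/
theorem litAt_of_le {φ : CNF ℕ} {q : ℕ} (hq : φ.length ≤ q) (l : ℕ) : litAt φ q l = none := by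
  simp [litAt, List.getElem?_eq_none hq]

/-- `litAt` inside a clause. [folklore] -/
theorem litAt_of_lt {φ : CNF ℕ} {q : ℕ} (hq : q < φ.length) {l : ℕ} (hl : l < φ[q].length) :
    litAt φ q l = some φ[q][l] := by
  simp [litAt, List.getElem?_eq_getElem hq, List.getElem?_eq_getElem hl]

/-- `litAt` past the end of a clause. [folklore] -/
theorem litAt_of_length_le {φ : CNF ℕ} {q : ℕ} (hq : q < φ.length) {l : ℕ} (hl : φ[q].length ≤ l) :
    litAt φ q l = none := by
  simp [litAt, List.getElem?_eq_getElem hq, List.getElem?_eq_none hl]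

namespace Params

variable (g : Params)

/-- The vertex-table value of vertex `a`: self-consistent and good, as `0`/`1`. [folklore] -/
def okVal (a : ℕ) : ℕ :=
  (!conflictB g.φ g.b (a / g.S) (a % g.S) (a / g.S) (a % g.S) && goodB g.φ g.b (a / g.S) (a % g.S)).toNat

/-- The adjacency bit of `(a, a')`, reduced modulo the emulated modulus. [folklore] -/
def adjVal (a a' : ℕ) : ℕ :=
  (adjB g.φ g.b g.S a a').toNat % g.Pw

/-- The emulated input: the `kClique` encoding of the position instance. [folklore] -/
noncomputable def y : List ℕ := kClique.encode (posInstance g.φ g.K)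

/-- Emulated cell `j` of the initial memory of the clique program on `y` (word size `ws`):
`|y|` in cell `0`, `y[j - 1]` in cell `j`, reduced modulo `Pw`, and `0` past the input.
[folklore] -/
noncomputable def ycell (j : ℕ) : ℕ :=
  if j = 0 then (g.N * g.N + 2) % g.Pw else (g.y.getD (j - 1) 0) % g.Pw

/-! ### The intended data memory, stage by stage

All stages agree below `V0` with the relocated input `relocated x`; a stage parameter says how
much of the tables / vertex table / matrix has been written. -/

/-- Data after `p` slots of the tables have been written. [folklore] -/
def tabData (p a : ℕ) : ℕ :=
  if a < g.V0 then relocated g.x a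
  else if a < g.P0 then (if a - g.V0 < p then varTab g.φ (a - g.V0) else 0)
  else if a < g.OK0 then (if a - g.P0 < p then polTab g.φ (a - g.P0) else 0)
  else 0

/-- Data after the tables and `p` entries of the vertex table. [folklore] -/
def okData (p a : ℕ) : ℕ :=
  if a < g.V0 then relocated g.x a
  else if a < g.P0 then varTab g.φ (a - g.V0)
  else if a < g.OK0 then polTab g.φ (a - g.P0)
  else if a < g.Bv then (if a - g.OK0 < p then g.okVal (a - g.OK0) else 0)
  else 0

/-- Data after the tables, the vertex table and `p` entries of the matrix (row-major). [folklore] -/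
def matData (p a : ℕ) : ℕ :=
  if a < g.V0 then relocated g.x a
  else if a < g.P0 then varTab g.φ (a - g.V0)
  else if a < g.OK0 then polTab g.φ (a - g.P0)
  else if a < g.Bv then g.okVal (a - g.OK0)
  else if a < g.Bv + 3 then 0
  else if a - (g.Bv + 3) < p then g.adjVal ((a - (g.Bv + 3)) / g.N) ((a - (g.Bv + 3)) % g.N)
  else 0

/-- The final data: tables, vertex table,
and the emulated input `y` (header and matrix). [folklore] -/
noncomputable def finData (a : ℕ) : ℕ :=
  if a < g.V0 then relocated g.x a
  else if a < g.P0 then varTab g.φ (a - g.V0)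
  else if a < g.OK0 then polTab g.φ (a - g.P0)
  else if a < g.Bv then g.okVal (a - g.OK0)
  else if a < g.Bv + (g.N * g.N + 3) then g.ycell (a - g.Bv)
  else 0

/-- **The final memory of the build**: registers `10–13` hold `Bv, Sv, 0, Pw`, every other
register is `0`, and the data is `finData`. [folklore] -/
noncomputable def finMem (a : ℕ) : ℕ :=
  if a < 100 then (if a = 10 then g.Bv else if a = 11 then g.Sv else if a = 13 then g.Pw else 0)
  else g.finData a

end Params

end CliqueRed

end Literature.Computability.FineGrained

namespace Literature.Computability.FineGrained

open Cryptography Cryptography.WordRAM Complexity Cryptography.WordRAM.SProg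

namespace CliqueRed

/-! ### Generic helpers -/

/-- The block rule from a memory split as `merge m m`, the result named. [folklore] -/
theorem achieves_block_of_eq {W : ℕ} {O : List ℕ → List ℕ} {ops : List OpSpec} {m : ℕ → ℕ}
    {Q : (ℕ → ℕ) → Prop} {T : ℕ} (h : ∀ m', m' = execOps W (merge m m) ops → Q m')
    (hT : ops.length ≤ T) : Achieves W O (block ops) m Q T := by
  have := h _ rfl; rw [merge_self] at this; exact Achieves.block this hT

/-- `(μ >>> t) &&& 1` is the bit `t` of `μ`. [folklore] -/
theorem shiftRight_and_one (μ t : ℕ) : (μ >>> t) &&& 1 = (μ.testBit t).toNat := by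
  rw [Nat.testBit, Nat.and_one_is_mod, Nat.shiftRight_eq_div_pow]
  rcases Nat.mod_two_eq_zero_or_one (μ / 2 ^ t) with h | h <;> simp [h, bne]

/-- Comparison results are bits. [folklore] -/
theorem ite_le_one (p : Prop) [Decidable p] : (if p then 1 else 0 : ℕ) ≤ 1 := by
  split_ifs <;> omega

/-- `Bool.toNat` is a bit. [folklore] -/
theorem toNat_lt_two (c : Bool) : c.toNat < 2 := by cases c <;> simp

/-- `band` of bits is the conjunction. [folklore] -/
theorem toNat_and_toNat (c d : Bool) : c.toNat &&& d.toNat = (c && d).toNat := by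
  cases c <;> cases d <;> rfl

/-- `bor` of bits is the disjunction. [folklore] -/
theorem toNat_or_toNat (c d : Bool) : c.toNat ||| d.toNat = (c || d).toNat := by
  cases c <;> cases d <;> rfl

/-- `< 1` on a bit is negation. [folklore] -/
theorem ite_toNat_lt_one (c : Bool) : (if c.toNat < 1 then 1 else 0 : ℕ) = (!c).toNat := by
  cases c <;> rfl

/-- `0 <` on a bit is the bit. [folklore] -/
theorem ite_zero_lt_toNat (c : Bool) : (if 0 < c.toNat then 1 else 0 : ℕ) = c.toNat := by
  cases c <;> rfl

/-- A decidable `if` as `Bool.toNat`. [folklore] -/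
theorem ite_eq_toNat_decide (p : Prop) [Decidable p] : (if p then 1 else 0 : ℕ) = (decide p).toNat := by
  by_cases h : p <;> simp [h]

namespace Params

variable (g : Params) {W : ℕ} {O : List ℕ → List ℕ}

/-! ### Register conventions -/

/-- The registers after the setup: `X, m, b, 3b, S, N, V₀, P₀, OK₀, Bv`. [folklore] -/
structure Regs (m : ℕ → ℕ) : Prop where
  r0 : m 0 = g.X
  r2 : m 2 = g.m
  r3 : m 3 = g.b
  r4 : m 4 = g.B3
  r5 : m 5 = g.S
  r6 : m 6 = g.N
  r7 : m 7 = g.V0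
  r8 : m 8 = g.P0
  r9 : m 9 = g.OK0
  r10 : m 10 = g.Bv

/-- The environment registers: `Sv, Gv = 0, Pw`. [folklore] -/
structure ERegs (m : ℕ → ℕ) : Prop where
  r11 : m 11 = g.Sv
  r12 : m 12 = 0
  r13 : m 13 = g.Pw

variable {g}

/-- `Regs` survives changes above register `10`. [folklore] -/
theorem Regs.of_frame {m m' : ℕ → ℕ} (h : g.Regs m) (hf : ∀ a, a ≤ 10 → m' a = m a) : g.Regs m' :=
  ⟨(hf 0 (by omega)).trans h.r0, (hf 2 (by omega)).trans h.r2, (hf 3 (by omega)).trans h.r3,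
    (hf 4 (by omega)).trans h.r4, (hf 5 (by omega)).trans h.r5, (hf 6 (by omega)).trans h.r6,
    (hf 7 (by omega)).trans h.r7, (hf 8 (by omega)).trans h.r8, (hf 9 (by omega)).trans h.r9,
    (hf 10 (by omega)).trans h.r10⟩

/-- `ERegs` survives changes outside `11–13`. [folklore] -/
theorem ERegs.of_frame {m m' : ℕ → ℕ} (h : g.ERegs m) (hf : ∀ a, 11 ≤ a → a ≤ 13 → m' a = m a) :
    g.ERegs m' :=
  ⟨(hf 11 (by omega) (by omega)).trans h.r11, (hf 12 (by omega) (by omega)).trans h.r12,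
    (hf 13 (by omega) (by omega)).trans h.r13⟩

variable (g)

/-! ### Reading the relocated input -/

/-- Cell `0` after relocation holds `X`. [folklore] -/
@[simp] theorem relocated_zero' : relocated g.x 0 = g.X := by
  rw [relocated_zero]; rfl

/-- Cell `1` after relocation holds `X - 1`. [folklore] -/
@[simp] theorem relocated_one' : relocated g.x 1 = g.X - 1 := by
  rw [relocated_one]; unfold X Lx; omega

/-- The relocated input: `x[j]` sits in cell `X + j` (and `0` past the input). [folklore] -/
theorem relocated_X_add (j : ℕ) : relocated g.x (g.X + j) = g.x.getD j 0 := by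
  by_cases hj : j < g.Lx
  · have := relocated_base_add g.x (i := j + 1) (by omega) (by unfold Lx at hj; omega)
    rw [show g.x.length + 100 + (j + 1) = g.X + j by unfold X Lx; omega] at this
    rw [this]; rfl
  · rw [relocated_of_lt g.x (by unfold X Lx at *; omega),
  List.getD_eq_default _ _ (by unfold Lx at hj; omega)]

/-- Everything above the relocated input is `0`. [folklore] -/
theorem relocated_of_V0_le {a : ℕ} (ha : g.V0 ≤ a) : relocated g.x a = 0 :=
  relocated_of_lt g.x (by unfold V0 X Lx at ha; omega)

/-- Word `1` of the input is `m`. [folklore] -/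
theorem x_getD_one : g.x.getD 1 0 = g.m := by
  have := encodeCNFWords_getElem?_one g.φ
  unfold x m; rw [List.getD_eq_getElem?_getD, this]; rfl

/-- Word `0` of the input is `n = numVars`. [folklore] -/
theorem x_getD_zero : g.x.getD 0 0 = g.φ.numVars := by
  have := encodeCNFWords_getElem?_zero g.φ
  unfold x; rw [List.getD_eq_getElem?_getD, this]; rfl

/-- `m + 2 ≤ Lx`. [folklore] -/
theorem m_add_two_le_Lx : g.m + 2 ≤ g.Lx := by
  unfold Lx x m; rw [length_encodeCNFWords_eq, CNF.numClauses]; omega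

/-- The standard linear facts about the ghost parameters under `Fits`. [folklore] -/
theorem facts (hF : g.Fits W) (hK : 2 ≤ g.K) :
    100 < g.X ∧ g.X = g.Lx + 101 ∧ g.X + g.Lx = g.V0 ∧ g.V0 + g.B3 * g.K = g.P0 ∧
    g.P0 + g.B3 * g.K = g.OK0 ∧ g.OK0 + g.N = g.Bv ∧ g.Bv + g.V + 1 = g.Sv ∧
    g.Sv + g.V + 1 ≤ 2 ^ W ∧ g.N * g.N + 2 ≤ g.V ∧ g.Pw ≤ g.V + 1 ∧ g.cM ≤ g.V ∧ g.K ≤ g.N ∧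
    g.S ≤ g.N ∧ g.m + 2 ≤ g.Lx ∧ g.B3 = 3 * g.b ∧ g.m ≤ g.b * g.K ∧ g.N ≤ g.N * g.N ∧
    3 * g.m ≤ g.B3 * g.K ∧ g.B3 ≤ g.B3 * g.K ∧ 1 ≤ g.Pw ∧ 1 ≤ g.S := by
  obtain ⟨h1, h2, h3, h4, h5, h6⟩ := g.bases
  obtain ⟨h7, h8, h9, h10, -⟩ := hF.bounds
  have hmb : g.m ≤ g.b * g.K := g.m_le (by omega)
  refine ⟨h1, rfl, h2, h3, h4, h5, h6, h7, h8, h9, h10, g.K_le_N,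
  Nat.le_mul_of_pos_left _ (by omega),
    g.m_add_two_le_Lx, rfl, hmb, Nat.le_mul_self _, ?_, Nat.le_mul_of_pos_right _ (by omega),
    Nat.one_le_two_pow, g.one_le_S⟩
  unfold B3; nlinarith

/-! ### The setup phase -/

/-- **Setup, part 1.** From the relocated memory, `setup1` computes the registers `Regs`, leaves
`r1 = X - 1`, `r21 = N² + 2`, `r22 = 0`, and does not touch the data. [folklore] -/
theorem setup1_spec (hF : g.Fits W) (hK : 2 ≤ g.K) :
    Achieves W O (setup1 g.K) (relocated g.x)
      (fun m => g.Regs m ∧ m 1 = g.X - 1 ∧ m 21 = g.N * g.N + 2 ∧ m 22 = 0 ∧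
        ∀ a, 100 ≤ a → m a = relocated g.x a) 17 := by
  obtain ⟨hX, hXLx, hV0, hP0, hOK0, hBv, hSv, htop, hNNV, hPwV, hcMV, hKN, hSN, hmLx, hB3, hmb,
    hNNN, h3m, hB3K, hPw1, hS1⟩ := g.facts hF hK
  have hb : (g.m + (g.K - 1)) / g.K = g.b := by
    unfold b blockLen; congr 1; omega
  have hS2 : 2 ^ g.B3 = g.S := rfl
  have hN : g.K * g.S = g.N := rfl
  have hB3' : g.b * 3 = g.B3 := by omega
  have hread : relocated g.x (g.X + 1) = g.m := by rw [relocated_X_add, x_getD_one]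
  refine achieves_block_of_eq (fun m' hm' => ?_) (by simp [])
  simp (disch := first | omega | decide) only [execOps_cons, execOps_nil, execOp, Operand.write,
    Operand.read, merge_apply_of_lt, merge_apply_of_le, update_merge_of_lt, Function.update_self,
    Function.update_of_ne, BinOp.eval_add_of_lt, BinOp.eval_sub_of_le, BinOp.eval_mul_of_lt,
    BinOp.eval_shl_of_lt, BinOp.eval_div, BinOp.eval_band, Nat.and_self, Nat.one_mul,
    relocated_zero', relocated_one', hread, hb, hS2, hB3', hN] at hm'
  subst hm'
  refine ⟨⟨?_, ?_, ?_, ?_, ?_, ?_, ?_, ?_, ?_, ?_⟩, ?_, ?_, ?_, fun a ha => ?_⟩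
  all_goals (try simp (disch := first | omega | decide) only [merge_apply_of_lt,
    merge_apply_of_le, Function.update_self, Function.update_of_ne])
  all_goals (try simp only [relocated_zero', relocated_one'])
  all_goals omega

/-- **Setup, part 2: the size loop.** From `r21 = v`, `r22 = 0`, the loop ends with
`r22 = Nat.size v`, `r21 = 0`, all other cells unchanged, within `4 · size v + 1` steps.
[folklore] -/
theorem sizeLoop_spec {m : ℕ → ℕ} {v : ℕ} (h21 : m 21 = v) (h22 : m 22 = 0) (hv : v < 2 ^ W) :
    Achieves W O sizeLoop m
      (fun m' => m' 22 = Nat.size v ∧ m' 21 = 0 ∧ ∀ a, a ≠ 21 → a ≠ 22 → m' a = m a)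
      (Nat.size v * 4 + 1) := by
  have hsz : Nat.size v ≤ W := Nat.size_le.2 hv
  have hW : W < 2 ^ W := Nat.lt_two_pow_self
  refine Achieves.whilenz (Nat.size v) 2
    (fun i m' => m' 21 = v / 2 ^ i ∧ m' 22 = i ∧ ∀ a, a ≠ 21 → a ≠ 22 → m' a = m a)
    (fun i hi m' ⟨h1, h2, h3⟩ => ⟨?_, ?_⟩) (fun m' ⟨h1, _, _⟩ => ?_) ⟨by simpa using h21, h22,
    fun a _ _ => rfl⟩ (fun m' ⟨h1, h2, h3⟩ => ⟨h2, ?_, h3⟩) le_rfl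
  · -- the test reads nonzero
    have : 2 ^ i ≤ v := Nat.lt_size.1 hi
    simp only [Operand.read, h1]
    exact (Nat.div_pos this (Nat.two_pow_pos i)).ne'
  · -- the body
    refine achieves_block_of_eq (fun m'' hm'' => ?_) le_rfl
    simp (disch := first | omega | decide) only [execOps_cons, execOps_nil, execOp, Operand.write,
      Operand.read, merge_apply_of_lt, update_merge_of_lt, Function.update_of_ne,
      BinOp.eval_add_of_lt, BinOp.eval_shr, h1, h2] at hm''
    subst hm''
    refine ⟨?_, ?_, fun a ha1 ha2 => ?_⟩
    · (try simp (disch := first | omega | decide) only [merge_apply_of_lt, Function.update_self,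
      Function.update_of_ne])
      rw [Nat.shiftRight_eq_div_pow, Nat.div_div_eq_div_mul, ← pow_succ]
    · (try simp (disch := first | omega | decide) only [merge_apply_of_lt, Function.update_self])
    · by_cases ha : a < 100
      · rw [merge_apply_of_lt ha, Function.update_of_ne ha2, Function.update_of_ne ha1,
      h3 a ha1 ha2]
      · rw [merge_apply_of_le (by omega), h3 a ha1 ha2]
  · -- exit
    simp only [Operand.read, h1]
    exact Nat.div_eq_of_lt (Nat.lt_size_self v)
  · rw [h1]; exact Nat.div_eq_of_lt (Nat.lt_size_self v)

/-- **Setup, part 3.** From the registers of `setup1` and `r22 = size (N² + 2)`, `setup3` sets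
the environment registers `Sv, Gv = 0, Pw` (`ERegs`), keeping `Regs` and the data. [folklore] -/
theorem setup3_spec (hF : g.Fits W) (hK : 2 ≤ g.K) {m : ℕ → ℕ} (hR : g.Regs m)
    (h22 : m 22 = Nat.size (g.N * g.N + 2)) (hD : ∀ a, 100 ≤ a → m a = relocated g.x a) :
    Achieves W O (setup3 g.kM g.cM) m
      (fun m' => g.Regs m' ∧ g.ERegs m' ∧ ∀ a, 100 ≤ a → m' a = relocated g.x a) 16 := by
  obtain ⟨hX, hXLx, hV0, hP0, hOK0, hBv, hSv, htop, hNNV, hPwV, hcMV, hKN, hSN, hmLx, hB3, hmb,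
    hNNN, h3m, hB3K, hPw1, hS1⟩ := g.facts hF hK
  have hwsW : g.ws < W := hF.ws_lt
  have hW : W < 2 ^ W := Nat.lt_two_pow_self
  have hws : Nat.size (g.N * g.N + 2) * g.kM = g.ws := Nat.mul_comm _ _
  have hPw : 2 ^ g.ws = g.Pw := rfl
  have hPwW : g.Pw < 2 ^ W := Nat.pow_lt_pow_right (by norm_num) hwsW
  obtain ⟨r0, r2, r3, r4, r5, r6, r7, r8, r9, r10⟩ := hR
  unfold setup3
  -- block 1
  refine Achieves.seqs_cons (R := fun m₁ => m₁ 13 = g.Pw ∧ m₁ 23 = g.Pw - 1 ∧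
      m₁ 24 = (if g.Pw - 1 < g.cM then 1 else 0) ∧ ∀ a, a ≠ 13 → a ≠ 22 → a ≠ 23 → a ≠ 24 →
        m₁ a = m a) (T₁ := 4) (T₂ := 12) ?_ ?_
  · refine achieves_block_of_eq (fun m' hm' => ?_) le_rfl
    simp (disch := first | omega | decide) only [execOps_cons, execOps_nil, execOp, Operand.write,
      Operand.read, merge_apply_of_lt, update_merge_of_lt, Function.update_self,
      BinOp.eval_sub_of_le, BinOp.eval_mul_of_lt, BinOp.eval_shl_of_lt, BinOp.eval_lt,
      Nat.one_mul, h22, hws, hPw] at hm'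
    subst hm'
    refine ⟨?_, ?_, ?_, fun a h1 h2 h3 h4 => ?_⟩
    · (try simp (disch := first | omega | decide) only [merge_apply_of_lt, Function.update_self,
      Function.update_of_ne])
    · (try simp (disch := first | omega | decide) only [merge_apply_of_lt, Function.update_self,
      Function.update_of_ne])
    · (try simp (disch := first | omega | decide) only [merge_apply_of_lt, Function.update_self])
    · by_cases ha : a < 100
      · rw [merge_apply_of_lt ha]; simp [Function.update_of_ne, h1, h2, h3, h4]
      · rw [merge_apply_of_le (by omega)]
  rintro m₁ ⟨q13, q23, q24, qf⟩
  -- ifz 1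
  refine Achieves.seqs_cons (R := fun m₂ => m₂ 23 = max (g.Pw - 1) g.cM ∧
      ∀ a, a ≠ 22 → a ≠ 23 → a ≠ 24 → m₂ a = m₁ a) (T₁ := 3) (T₂ := 9) ?_ ?_
  · refine Achieves.ifz (fun h0 => Achieves.skip ⟨?_, fun a _ _ _ => rfl⟩) (fun h1 => ?_)
    · simp only [Operand.read, q24] at h0
      have hc : ¬ g.Pw - 1 < g.cM := fun hc => by simp [hc] at h0
      rw [q23, max_eq_left (not_lt.1 hc)]
    · simp only [Operand.read, q24] at h1
      have hlt : g.Pw - 1 < g.cM := by by_contra hc; simp [hc] at h1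
      refine achieves_block_of_eq (fun m' hm' => ?_) le_rfl
      simp (disch := first | omega | decide) only [execOps_cons, execOps_nil, execOp,
        Operand.write, Operand.read, update_merge_of_lt, BinOp.eval_band, Nat.and_self] at hm'
      subst hm'
      refine ⟨?_, fun a _ h23 _ => ?_⟩
      · (try simp (disch := first | omega | decide) only [merge_apply_of_lt,
        Function.update_self]); rw [max_eq_right hlt.le]
      · by_cases ha : a < 100
        · rw [merge_apply_of_lt ha, Function.update_of_ne h23]
        · rw [merge_apply_of_le (by omega)]
  rintro m₂ ⟨p23, pf⟩
  have p6 : m₂ 6 = g.N := by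
    rw [pf 6 (by omega) (by omega) (by omega), qf 6 (by omega) (by omega) (by omega) (by omega), r6]
  have hmaxV : max (g.Pw - 1) g.cM ≤ g.V := max_le (by omega) hcMV
  -- block 2
  refine Achieves.seqs_cons (R := fun m₃ => m₃ 23 = max (g.Pw - 1) g.cM ∧
      m₃ 25 = g.N * g.N + 2 ∧ m₃ 24 = (if max (g.Pw - 1) g.cM < g.N * g.N + 2 then 1 else 0) ∧
      ∀ a, a ≠ 22 → a ≠ 23 → a ≠ 24 → a ≠ 25 → m₃ a = m₁ a) (T₁ := 3) (T₂ := 6) ?_ ?_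
  · refine achieves_block_of_eq (fun m' hm' => ?_) le_rfl
    simp (disch := first | omega | decide) only [execOps_cons, execOps_nil, execOp, Operand.write,
      Operand.read, merge_apply_of_lt, update_merge_of_lt, Function.update_self,
      Function.update_of_ne, BinOp.eval_add_of_lt, BinOp.eval_mul_of_lt, BinOp.eval_lt, p23,
      p6] at hm'
    subst hm'
    refine ⟨?_, ?_, ?_, fun a h1 h2 h3 h4 => ?_⟩
    · (try simp (disch := first | omega | decide) only [merge_apply_of_lt,
      Function.update_of_ne]); exact p23
    · (try simp (disch := first | omega | decide) only [merge_apply_of_lt, Function.update_self,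
      Function.update_of_ne])
    · (try simp (disch := first | omega | decide) only [merge_apply_of_lt, Function.update_self])
    · by_cases ha : a < 100
      · rw [merge_apply_of_lt ha]; simp [Function.update_of_ne, h3, h4, pf a h1 h2 h3]
      · rw [merge_apply_of_le (by omega), pf a h1 h2 h3]
  rintro m₃ ⟨s23, s25, s24, sf⟩
  -- ifz 2
  refine Achieves.seqs_cons (R := fun m₄ => m₄ 23 = g.V ∧
      ∀ a, a ≠ 22 → a ≠ 23 → a ≠ 24 → a ≠ 25 → m₄ a = m₁ a) (T₁ := 3) (T₂ := 3) ?_ ?_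
  · refine Achieves.ifz (fun h0 => Achieves.skip ⟨?_, sf⟩) (fun h1 => ?_)
    · simp only [Operand.read, s24] at h0
      have hc : ¬ max (g.Pw - 1) g.cM < g.N * g.N + 2 := fun hc => by simp [hc] at h0
      rw [s23]; show _ = max (g.Pw - 1) (max g.cM (g.N * g.N + 2))
      rw [← max_assoc, max_eq_left (not_lt.1 hc)]
    · simp only [Operand.read, s24] at h1
      have hlt : max (g.Pw - 1) g.cM < g.N * g.N + 2 := by by_contra hc; simp [hc] at h1
      refine achieves_block_of_eq (fun m' hm' => ?_) le_rfl
      simp (disch := first | omega | decide) only [execOps_cons, execOps_nil, execOp,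
        Operand.write, Operand.read, merge_apply_of_lt, update_merge_of_lt, BinOp.eval_band,
        Nat.and_self, s25] at hm'
      subst hm'
      refine ⟨?_, fun a h22 h23 h24 h25 => ?_⟩
      · (try simp (disch := first | omega | decide) only [merge_apply_of_lt,
        Function.update_self]); show _ = max (g.Pw - 1) (max g.cM (g.N * g.N + 2))
        rw [← max_assoc, max_eq_right hlt.le]
      · by_cases ha : a < 100
        · rw [merge_apply_of_lt ha, Function.update_of_ne h23, sf a h22 h23 h24 h25]
        · rw [merge_apply_of_le (by omega), sf a h22 h23 h24 h25]
  rintro m₄ ⟨t23, tf⟩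
  have back : ∀ a, a ≠ 13 → a ≠ 22 → a ≠ 23 → a ≠ 24 → a ≠ 25 → m₄ a = m a :=
    fun a h1 h2 h3 h4 h5 => by rw [tf a h2 h3 h4 h5, qf a h1 h2 h3 h4]
  have t10 : m₄ 10 = g.Bv := by
    rw [back 10 (by omega) (by omega) (by omega) (by omega) (by omega), r10]
  -- block 3
  refine Achieves.seqs_cons (T₁ := 3) (T₂ := 0) ?_ (fun _ h => Achieves.seqs_nil h)
  refine achieves_block_of_eq (fun m' hm' => ?_) le_rfl
  simp (disch := first | omega | decide) only [execOps_cons, execOps_nil, execOp, Operand.write,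
    Operand.read, merge_apply_of_lt, update_merge_of_lt, Function.update_self,
    BinOp.eval_add_of_lt, BinOp.eval_band, Nat.and_self, t23, t10] at hm'
  subst hm'
  refine ⟨⟨?_, ?_, ?_, ?_, ?_, ?_, ?_, ?_, ?_, ?_⟩, ⟨?_, ?_, ?_⟩, fun a ha => ?_⟩
  all_goals (try simp (disch := first | omega | decide) only [merge_apply_of_lt,
    merge_apply_of_le, Function.update_self, Function.update_of_ne])
  · rw [back 0 (by omega) (by omega) (by omega) (by omega) (by omega), r0]
  · rw [back 2 (by omega) (by omega) (by omega) (by omega) (by omega), r2]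
  · rw [back 3 (by omega) (by omega) (by omega) (by omega) (by omega), r3]
  · rw [back 4 (by omega) (by omega) (by omega) (by omega) (by omega), r4]
  · rw [back 5 (by omega) (by omega) (by omega) (by omega) (by omega), r5]
  · rw [back 6 (by omega) (by omega) (by omega) (by omega) (by omega), r6]
  · rw [back 7 (by omega) (by omega) (by omega) (by omega) (by omega), r7]
  · rw [back 8 (by omega) (by omega) (by omega) (by omega) (by omega), r8]
  · rw [back 9 (by omega) (by omega) (by omega) (by omega) (by omega), r9]
  · exact t10
  · omega
  · rw [tf 13 (by omega) (by omega) (by omega) (by omega), q13]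
  · rw [back a (by omega) (by omega) (by omega) (by omega) (by omega), hD a ha]

end Params

end CliqueRed

end Literature.Computability.FineGrained

namespace Literature.Computability.FineGrained

open Cryptography Cryptography.WordRAM Complexity Cryptography.WordRAM.SProg

namespace CliqueRed

/-! ### Facts about the encoding and the tables -/

/-- Members are bounded by `foldr max`. [folklore] -/
theorem le_foldr_max_of_mem {l : List ℕ} {v : ℕ} (h : v ∈ l) (b : ℕ) : v ≤ l.foldr max b := by
  induction l with
  | nil => simp at h
  | cons a l ih =>
    simp only [List.foldr_cons]
    rcases List.mem_cons.1 h with rfl | h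
    · exact le_max_left _ _
    · exact (ih h).trans (le_max_right _ _)

/-- Every occurring variable is below `numVars`. [folklore] -/
theorem lt_numVars_of_mem {φ : CNF ℕ} {c : Clause ℕ} (hc : c ∈ φ) {l : Literal ℕ} (hl : l ∈ c) :
    l.1 < φ.numVars := by
  have : l.1 + 1 ∈ φ.flatten.map fun l => l.1 + 1 :=
    List.mem_map.2 ⟨l, List.mem_flatten.2 ⟨c, hc, hl⟩, rfl⟩
  exact Nat.lt_of_succ_le (le_foldr_max_of_mem this 0)

/-- The halves of a literal code. [folklore] -/
theorem litCode_shiftRight_one (l : Literal ℕ) : litCode l >>> 1 = l.1 := by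
  rw [Nat.shiftRight_eq_div_pow, pow_one, litCode]
  cases l.2 <;> simp [Nat.mul_add_div] 

/-- The low bit of a literal code. [folklore] -/
theorem litCode_and_one (l : Literal ℕ) : litCode l &&& 1 = l.2.toNat := by
  rw [Nat.and_one_is_mod, litCode]
  cases l.2 <;> simp []

/-- `varTab` at slot `3q + l`. [folklore] -/
theorem varTab_three_mul_add (φ : CNF ℕ) (q : ℕ) {l : ℕ} (hl : l < 3) :
    varTab φ (3 * q + l) = match litAt φ q l with | some lit => lit.1 + 1 | none => 0 := by
  unfold varTab; rw [Nat.mul_add_div (by norm_num), Nat.div_eq_of_lt hl, Nat.add_zero,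
    Nat.mul_add_mod, Nat.mod_eq_of_lt hl]

/-- `polTab` at slot `3q + l`. [folklore] -/
theorem polTab_three_mul_add (φ : CNF ℕ) (q : ℕ) {l : ℕ} (hl : l < 3) :
    polTab φ (3 * q + l) = match litAt φ q l with | some lit => lit.2.toNat | none => 0 := by
  unfold polTab; rw [Nat.mul_add_div (by norm_num), Nat.div_eq_of_lt hl, Nat.add_zero,
    Nat.mul_add_mod, Nat.mod_eq_of_lt hl]

/-- Every slot index splits as `3q + l`, `l < 3`. [folklore] -/
theorem exists_eq_three_mul_add (s : ℕ) : ∃ q l, l < 3 ∧ s = 3 * q + l :=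
  ⟨s / 3, s % 3, Nat.mod_lt _ (by norm_num), (Nat.div_add_mod s 3).symm⟩

namespace Params

variable (g : Params) {W : ℕ} {O : List ℕ → List ℕ}

/-- The length word of clause `q` in the input. [folklore] -/
theorem x_getD_clauseStart {q : ℕ} (hq : q < g.m) :
    g.x.getD (clauseStart g.φ q) 0 = (g.φ[q]'hq).length := by
  have := encodeCNFWords_getElem?_clauseStart g.φ hq
  unfold x; rw [List.getD_eq_getElem?_getD, this]; rfl

/-- The literal words of clause `q` in the input. [folklore] -/
theorem x_getD_lit {q : ℕ} (hq : q < g.m) {l : ℕ} (hl : l < (g.φ[q]'hq).length) :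
    g.x.getD (clauseStart g.φ q + 1 + l) 0 = litCode ((g.φ[q]'hq)[l]'hl) := by
  have := encodeCNFWords_getElem?_clauseStart_succ g.φ hq hl
  unfold x; rw [List.getD_eq_getElem?_getD, this]; rfl

/-- Clause blocks lie inside the input. [folklore] -/
theorem clauseStart_le {q : ℕ} (hq : q < g.m) :
    clauseStart g.φ q + 1 + (g.φ[q]'hq).length ≤ g.Lx := by
  have := clauseStart_add_length_le g.φ hq; unfold Lx x; exact this

/-- `clauseStart` at `m` is at most `Lx`. [folklore] -/
theorem clauseStart_m_le : clauseStart g.φ g.m ≤ g.Lx := by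
  unfold Lx x m; rw [length_encodeCNFWords]

/-- The table values are small: `varTab ≤ numVars`, `polTab ≤ 1`. [folklore] -/
theorem varTab_le (s : ℕ) : varTab g.φ s ≤ g.φ.numVars ∧ polTab g.φ s ≤ 1 := by
  unfold varTab polTab
  cases h : litAt g.φ (s / 3) (s % 3) with
  | none => simp
  | some lit =>
    simp only
    unfold litAt at h
    cases hc : g.φ[s / 3]? with
    | none => rw [hc] at h; simp at h
    | some cl =>
      rw [hc, Option.bind_some] at h
      exact ⟨lt_numVars_of_mem (List.mem_of_getElem? hc) (List.mem_of_getElem? h),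
        Bool.toNat_le _⟩

/-- `numVars` is an input word, hence below `2 ^ W`. [folklore] -/
theorem numVars_lt (hF : g.Fits W) : g.φ.numVars < 2 ^ W := by
  have h := hF.input (g.x.getD 0 0) (by
    rw [List.getD_eq_getElem _ _ (by have := g.two_le_Lx; unfold Lx at this; omega)]
    exact List.getElem_mem _)
  rwa [x_getD_zero] at h

/-! ### Stepping the table data -/

/-- Below `V0` every stage of the data is the relocated input. [folklore] -/
theorem tabData_of_lt_V0 (p : ℕ) {a : ℕ} (ha : a < g.V0) : g.tabData p a = relocated g.x a := by
  unfold tabData; rw [if_pos ha]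

/-- **One slot written**: writing `varTab p` at `V0 + p` and `polTab p` at `P0 + p` turns stage `p`
into stage `p + 1`. [folklore] -/
theorem tabData_succ {p : ℕ} (hp : p < g.B3 * g.K) {m : ℕ → ℕ}
    (hm : ∀ a, 100 ≤ a → m a = g.tabData p a) (a : ℕ) (ha : 100 ≤ a) :
    Function.update (Function.update m (g.V0 + p) (varTab g.φ p)) (g.P0 + p) (polTab g.φ p) a =
      g.tabData (p + 1) a := by
  obtain ⟨hX, hV0, hP0, hOK0, -⟩ := g.bases
  by_cases h1 : a = g.P0 + p
  · subst h1; rw [Function.update_self]; unfold tabData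
    rw [if_neg (by omega), if_neg (by omega), if_pos (by omega), if_pos (by omega),
    Nat.add_sub_cancel_left]
  rw [Function.update_of_ne h1]
  by_cases h2 : a = g.V0 + p
  · subst h2; rw [Function.update_self]; unfold tabData
    rw [if_neg (by omega), if_pos (by omega), if_pos (by omega), Nat.add_sub_cancel_left]
  rw [Function.update_of_ne h2, hm a ha]
  unfold tabData
  by_cases h3 : a < g.V0
  · rw [if_pos h3, if_pos h3]
  rw [if_neg h3, if_neg h3]
  by_cases h4 : a < g.P0
  · rw [if_pos h4, if_pos h4]
    have : (a - g.V0 < p) ↔ (a - g.V0 < p + 1) := by omega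
    simp only [this]
  rw [if_neg h4, if_neg h4]
  by_cases h5 : a < g.OK0
  · rw [if_pos h5, if_pos h5]
    have : (a - g.P0 < p) ↔ (a - g.P0 < p + 1) := by omega
    simp only [this]
  rw [if_neg h5, if_neg h5]

/-- Stages agree when the slots in between carry no literal. [folklore] -/
theorem tabData_eq_of_empty {p p' : ℕ} (hpp : p ≤ p')
    (h : ∀ s, p ≤ s → s < p' → varTab g.φ s = 0 ∧ polTab g.φ s = 0) (a : ℕ) :
    g.tabData p a = g.tabData p' a := by
  unfold tabData
  by_cases h3 : a < g.V0
  · rw [if_pos h3, if_pos h3]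
  rw [if_neg h3, if_neg h3]
  by_cases h4 : a < g.P0
  · rw [if_pos h4, if_pos h4]
    by_cases h6 : a - g.V0 < p
    · rw [if_pos h6, if_pos (by omega)]
    rw [if_neg h6]
    by_cases h7 : a - g.V0 < p'
    · rw [if_pos h7, (h _ (by omega) h7).1]
    rw [if_neg h7]
  rw [if_neg h4, if_neg h4]
  by_cases h5 : a < g.OK0
  · rw [if_pos h5, if_pos h5]
    by_cases h6 : a - g.P0 < p
    · rw [if_pos h6, if_pos (by omega)]
    rw [if_neg h6]
    by_cases h7 : a - g.P0 < p'
    · rw [if_pos h7, (h _ (by omega) h7).2]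
    rw [if_neg h7]
  rw [if_neg h5, if_neg h5]

/-- Stage `0` of the tables is the relocated memory (above the registers). [folklore] -/
theorem tabData_zero (a : ℕ) : g.tabData 0 a = relocated g.x a := by
  unfold tabData
  by_cases h3 : a < g.V0
  · rw [if_pos h3]
  rw [if_neg h3, g.relocated_of_V0_le (not_lt.1 h3)]
  split_ifs <;> first | rfl | omega

/-! ### The inner loop: the literals of one clause -/

/-- The invariant of the literal loop of clause `q` after `l` literals. [folklore] -/
structure TabIn (q Lq l : ℕ) (m : ℕ → ℕ) : Prop where
  regs : g.Regs m
  eregs : g.ERegs m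
  r20 : m 20 = g.X + (clauseStart g.φ q + 1 + l)
  r21 : m 21 = 3 * q
  r22 : m 22 = g.m - q
  r23 : m 23 = Lq - l
  r24 : m 24 = l
  data : ∀ a, 100 ≤ a → m a = g.tabData (3 * q + l) a

/-- **The literal loop of clause `q`.** [folklore] -/
theorem tabLit_loop (hF : g.Fits W) (hK : 2 ≤ g.K) (hw : g.φ.IsWidthLE 3) {q : ℕ} (hq : q < g.m)
    {m : ℕ → ℕ} (h0 : g.TabIn q (g.φ[q]'hq).length 0 m) :
    Achieves W O (whilenz (r 23) tabLit) m (g.TabIn q (g.φ[q]'hq).length (g.φ[q]'hq).length) 46 := by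
  obtain ⟨hX, hXLx, hV0, hP0, hOK0, hBv, hSv, htop, hNNV, hPwV, hcMV, hKN, hSN, hmLx, hB3, hmb,
    hNNN, h3m, hB3K, hPw1, hS1⟩ := g.facts hF hK
  set Lq := (g.φ[q]'hq).length with hLq
  have hLq3 : Lq ≤ 3 := hw _ (List.getElem_mem hq)
  have hcs : clauseStart g.φ q + 1 + Lq ≤ g.Lx := g.clauseStart_le hq
  have hnv : g.φ.numVars < 2 ^ W := g.numVars_lt hF
  refine Achieves.whilenz Lq 13 (fun l => g.TabIn q Lq l) (fun l hl m' hI => ⟨?_, ?_⟩)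
    (fun m' hI => ?_) h0 (fun _ h => h) (by omega)
  · simp only [Operand.read, hI.r23]; omega
  · obtain ⟨⟨r0, r2, r3, r4, r5, r6, r7, r8, r9, r10⟩, ⟨r11, r12, r13⟩, r20, r21, r22, r23, r24,
  hD⟩ := hI
    -- the literal read
    set lit : Literal ℕ := (g.φ[q]'hq)[l]'hl with hlit
    have hread : m' (g.X + (clauseStart g.φ q + 1 + l)) = litCode lit := by
      rw [hD _ (by omega), g.tabData_of_lt_V0 _ (by omega), relocated_X_add, g.x_getD_lit hq hl]
    have hvar : lit.1 < g.φ.numVars :=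
      lt_numVars_of_mem (List.getElem_mem hq) (List.getElem_mem hl)
    have hpol : lit.2.toNat ≤ 1 := Bool.toNat_le _
    have hsl : 3 * q + l < g.B3 * g.K := by omega
    refine achieves_block_of_eq (fun m'' hm'' => ?_) le_rfl
    simp (disch := first | omega | decide) only [execOps_cons, execOps_nil, execOp, Operand.write,
      Operand.read, merge_apply_of_lt, merge_apply_of_le, update_merge_of_lt, update_merge_of_le,
      Function.update_self, Function.update_of_ne, BinOp.eval_add_of_lt, BinOp.eval_sub_of_le,
      BinOp.eval_band, BinOp.eval_shr, Nat.and_self, r7, r8, r20, r21, r24, r23, hread,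
      litCode_shiftRight_one, litCode_and_one] at hm''
    subst hm''
    have hvt : varTab g.φ (3 * q + l) = lit.1 + 1 := by
      rw [varTab_three_mul_add _ _ (by omega), litAt_of_lt hq hl]
    have hpt : polTab g.φ (3 * q + l) = lit.2.toNat := by
      rw [polTab_three_mul_add _ _ (by omega), litAt_of_lt hq hl]
    refine ⟨⟨?_, ?_, ?_, ?_, ?_, ?_, ?_, ?_, ?_, ?_⟩, ⟨?_, ?_, ?_⟩, ?_, ?_, ?_, ?_, ?_,
    fun a ha => ?data⟩
    case data =>
      (try simp (disch := first | omega | decide) only [merge_apply_of_le])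
      rw [show g.V0 + 3 * q + l = g.V0 + (3 * q + l) by omega,
        show g.P0 + 3 * q + l = g.P0 + (3 * q + l) by omega, ← hvt, ← hpt,
        show 3 * q + (l + 1) = 3 * q + l + 1 by omega]
      exact g.tabData_succ hsl hD a ha
    all_goals (try simp (disch := first | omega | decide) only [merge_apply_of_lt,
      Function.update_self, Function.update_of_ne])
    all_goals first | assumption | omega
  · simp only [Operand.read, hI.r23]; omega

/-! ### The outer loop: the clauses -/

/-- The invariant of the clause loop after `q` clauses. [folklore] -/
structure TabOut (q : ℕ) (m : ℕ → ℕ) : Prop where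
  regs : g.Regs m
  eregs : g.ERegs m
  r20 : m 20 = g.X + clauseStart g.φ q
  r21 : m 21 = 3 * q
  r22 : m 22 = g.m - q
  data : ∀ a, 100 ≤ a → m a = g.tabData (3 * q) a

/-- **One clause.** [folklore] -/
theorem tabClause_spec (hF : g.Fits W) (hK : 2 ≤ g.K) (hw : g.φ.IsWidthLE 3) {q : ℕ} (hq : q < g.m)
    {m : ℕ → ℕ} (h0 : g.TabOut q m) : Achieves W O tabClause m (g.TabOut (q + 1)) 51 := by
  obtain ⟨hX, hXLx, hV0, hP0, hOK0, hBv, hSv, htop, hNNV, hPwV, hcMV, hKN, hSN, hmLx, hB3, hmb,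
    hNNN, h3m, hB3K, hPw1, hS1⟩ := g.facts hF hK
  obtain ⟨hR, hE, r20, r21, r22, hD⟩ := h0
  set Lq := (g.φ[q]'hq).length with hLq
  have hLq3 : Lq ≤ 3 := hw _ (List.getElem_mem hq)
  have hcs : clauseStart g.φ q + 1 + Lq ≤ g.Lx := g.clauseStart_le hq
  have hread : m (g.X + clauseStart g.φ q) = Lq := by
    rw [hD _ (by omega), g.tabData_of_lt_V0 _ (by omega), relocated_X_add, g.x_getD_clauseStart hq]
  unfold tabClause
  refine Achieves.seqs_cons (R := g.TabIn q Lq 0) (T₁ := 3) (T₂ := 48) ?_ fun m₁ h₁ => ?_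
  · obtain ⟨r0, r2, r3, r4, r5, r6, r7, r8, r9, r10⟩ := hR
    obtain ⟨r11, r12, r13⟩ := hE
    refine achieves_block_of_eq (fun m' hm' => ?_) le_rfl
    simp (disch := first | omega | decide) only [execOps_cons, execOps_nil, execOp, Operand.write,
      Operand.read, merge_apply_of_lt, merge_apply_of_le, update_merge_of_lt,
      Function.update_of_ne, BinOp.eval_add_of_lt, BinOp.eval_band, Nat.and_self, r20, hread] at hm'
    subst hm'
    refine ⟨⟨?_, ?_, ?_, ?_, ?_, ?_, ?_, ?_, ?_, ?_⟩, ⟨?_, ?_, ?_⟩, ?_, ?_, ?_, ?_, ?_,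
    fun a ha => ?data⟩
    case data => (try simp (disch := first | omega | decide) only [merge_apply_of_le]); rw [Nat.add_zero]; exact hD a ha
    all_goals (try simp (disch := first | omega | decide) only [merge_apply_of_lt,
      Function.update_self, Function.update_of_ne])
    all_goals first | assumption | omega
  refine Achieves.seqs_cons (R := g.TabIn q Lq Lq) (T₁ := 46) (T₂ := 2) (g.tabLit_loop hF hK hw hq h₁)
    fun m₂ h₂ => ?_
  obtain ⟨⟨r0, r2, r3, r4, r5, r6, r7, r8, r9, r10⟩, ⟨r11, r12, r13⟩, s20, s21, s22, s23, s24,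
  sD⟩ := h₂
  refine Achieves.seqs_cons (T₁ := 2) (T₂ := 0) ?_ (fun _ h => Achieves.seqs_nil h)
  refine achieves_block_of_eq (fun m' hm' => ?_) le_rfl
  simp (disch := first | omega | decide) only [execOps_cons, execOps_nil, execOp, Operand.write,
    Operand.read, merge_apply_of_lt, update_merge_of_lt, Function.update_of_ne,
    BinOp.eval_add_of_lt, BinOp.eval_sub_of_le, s21, s22] at hm'
  subst hm'
  have htab : ∀ a, g.tabData (3 * q + Lq) a = g.tabData (3 * (q + 1)) a :=
    g.tabData_eq_of_empty (by omega) fun s hs hs' => by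
      obtain ⟨q', l, hl, rfl⟩ := exists_eq_three_mul_add s
      have hq' : q' = q := by omega
      subst hq'
      rw [varTab_three_mul_add _ _ hl, polTab_three_mul_add _ _ hl,
        litAt_of_length_le hq (by omega)]
      exact ⟨rfl, rfl⟩
  have hcs' := clauseStart_succ g.φ hq
  refine ⟨⟨?_, ?_, ?_, ?_, ?_, ?_, ?_, ?_, ?_, ?_⟩, ⟨?_, ?_, ?_⟩, ?_, ?_, ?_, fun a ha => ?data⟩
  case data => (try simp (disch := first | omega | decide) only [merge_apply_of_le]); rw [sD a ha,
    htab]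
  all_goals (try simp (disch := first | omega | decide) only [merge_apply_of_lt,
    Function.update_self, Function.update_of_ne])
  all_goals first | assumption | omega

/-- **The slot tables.** From the setup registers and the relocated data, `tables` fills the
slot-variable and slot-polarity tables: the data becomes `tabData (3 m)`, i.e. (all later slots
being empty) the full tables. [folklore] -/
theorem tables_spec (hF : g.Fits W) (hK : 2 ≤ g.K) (hw : g.φ.IsWidthLE 3) {m : ℕ → ℕ}
    (hR : g.Regs m) (hE : g.ERegs m) (hD : ∀ a, 100 ≤ a → m a = relocated g.x a) :
    Achieves W O tables m (g.TabOut g.m) (g.m * 53 + 4) := by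
  obtain ⟨hX, hXLx, hV0, hP0, hOK0, hBv, hSv, htop, hNNV, hPwV, hcMV, hKN, hSN, hmLx, hB3, hmb,
    hNNN, h3m, hB3K, hPw1, hS1⟩ := g.facts hF hK
  unfold tables
  refine Achieves.mono (T := 3 + (g.m * 53 + 1)) ?_ (fun _ h => h) (by omega)
  refine Achieves.seqs_cons (R := g.TabOut 0) (T₁ := 3) (T₂ := g.m * 53 + 1) ?_ fun m₁ h₁ => ?_
  · obtain ⟨r0, r2, r3, r4, r5, r6, r7, r8, r9, r10⟩ := hR
    obtain ⟨r11, r12, r13⟩ := hE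
    refine achieves_block_of_eq (fun m' hm' => ?_) le_rfl
    simp (disch := first | omega | decide) only [execOps_cons, execOps_nil, execOp, Operand.write,
      Operand.read, merge_apply_of_lt, update_merge_of_lt, Function.update_of_ne,
      BinOp.eval_add_of_lt, BinOp.eval_band, Nat.and_self, r0, r2] at hm'
    subst hm'
    have hcs0 := clauseStart_zero g.φ
    refine ⟨⟨?_, ?_, ?_, ?_, ?_, ?_, ?_, ?_, ?_, ?_⟩, ⟨?_, ?_, ?_⟩, ?_, ?_, ?_, fun a ha => ?data⟩
    case data => (try simp (disch := first | omega | decide) only [merge_apply_of_le]); rw [Nat.mul_zero, g.tabData_zero]; exact hD a ha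
    all_goals (try simp (disch := first | omega | decide) only [merge_apply_of_lt,
      Function.update_self, Function.update_of_ne])
    all_goals first | assumption | omega
  refine Achieves.seqs_cons (T₁ := g.m * 53 + 1) (T₂ := 0) ?_ (fun _ h => Achieves.seqs_nil h)
  refine Achieves.whilenz g.m 51 (fun q => g.TabOut q) (fun q hq m' hI => ⟨?_, ?_⟩)
    (fun m' hI => ?_) h₁ (fun _ h => h) (by omega)
  · simp only [Operand.read, hI.r22]; omega
  · exact g.tabClause_spec hF hK hw hq hI
  · simp only [Operand.read, hI.r22]; omega

end Params

end CliqueRed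

end Literature.Computability.FineGrained

namespace Literature.Computability.FineGrained

open Cryptography Cryptography.WordRAM Complexity Cryptography.WordRAM.SProg

namespace CliqueRed

/-! ### Partial conflicts -/

/-- The conflict bit of one pair of slots. [folklore] -/
def pairConf (φ : CNF ℕ) (b i μ j ν t u : ℕ) : Bool :=
  (slotLit φ b i t).isSome && ((slotLit φ b i t).map Prod.fst == (slotLit φ b j u).map Prod.fst) &&
    (μ.testBit t != ν.testBit u)

/-- The conflicts found after the rows `< t` and the first `u` pairs of row `t`. [folklore] -/
def confUpTo (φ : CNF ℕ) (b i μ j ν t u : ℕ) : Bool :=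
  ((List.range t).any fun t' => (List.range (3 * b)).any (pairConf φ b i μ j ν t')) ||
    (List.range u).any (pairConf φ b i μ j ν t)

section Conf

variable (φ : CNF ℕ) (b i μ j ν : ℕ)

/-- No pair examined: no conflict. [folklore] -/
theorem confUpTo_zero : confUpTo φ b i μ j ν 0 0 = false := by simp [confUpTo]

/-- One more pair. [folklore] -/
theorem confUpTo_succ (t u : ℕ) :
    confUpTo φ b i μ j ν t (u + 1) = (confUpTo φ b i μ j ν t u || pairConf φ b i μ j ν t u) := by
  simp [confUpTo, List.range_succ, List.any_append, Bool.or_assoc]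

/-- A finished row. [folklore] -/
theorem confUpTo_row (t : ℕ) : confUpTo φ b i μ j ν t (3 * b) = confUpTo φ b i μ j ν (t + 1) 0 := by
  simp [confUpTo, List.range_succ, List.any_append]

/-- All rows: the conflict bit. [folklore] -/
theorem confUpTo_done : confUpTo φ b i μ j ν (3 * b) 0 = conflictB φ b i μ j ν := by
  unfold confUpTo conflictB pairConf; simp

end Conf

/-- `band` of comparison bits is the conjunction. [folklore] -/
theorem ite_and_ite (p q : Prop) [Decidable p] [Decidable q] :
    ((if p then 1 else 0 : ℕ) &&& (if q then 1 else 0)) = if p ∧ q then 1 else 0 := by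
  by_cases hp : p <;> by_cases hq : q <;> simp [hp, hq]

/-- **The arithmetic of one step of `conf`**: OR-ing into the bit `c` the conjunction of the three
comparison bits `p`, `q`, `¬ r`, all computed with `eq`/`band`/`lt`. [folklore] -/
theorem conf_step (c : Bool) (p q r : Prop) [Decidable p] [Decidable q] [Decidable r] :
    (if ((if c.toNat = 0 then 1 else 0) &&&
        (if ((if p then 1 else 0) &&& (if q then 1 else 0) &&&
          (if (if r then 1 else 0) < 1 then 1 else 0)) = 0 then 1 else 0)) < 1 then 1 else 0) =
      (c || (decide p && decide q && !decide r)).toNat := by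
  simp only [ite_and_ite]
  cases c <;> by_cases h1 : p <;> by_cases h2 : q <;> by_cases h3 : r <;> simp [h1, h2, h3]

namespace Params

variable (g : Params) {W : ℕ} {O : List ℕ → List ℕ}

/-- The slot-variable table at a block slot. [folklore] -/
theorem varTab_slot (i t : ℕ) : varTab g.φ (i * g.B3 + t) =
    match slotLit g.φ g.b i t with | some l => l.1 + 1 | none => 0 := by
  have : i * g.B3 + t = 3 * (i * g.b) + t := by unfold B3; ring
  unfold varTab; rw [this, litAt_slot]

/-- The polarity table at a block slot. [folklore] -/
theorem polTab_slot (i t : ℕ) : polTab g.φ (i * g.B3 + t) =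
    match slotLit g.φ g.b i t with | some l => l.2.toNat | none => 0 := by
  have : i * g.B3 + t = 3 * (i * g.b) + t := by unfold B3; ring
  unfold polTab; rw [this, litAt_slot]

/-- **The pair-conflict bit as computed**: slot nonempty, equal table values, different mask bits.
[folklore] -/
theorem pairConf_eq (i μ j ν t u : ℕ) : pairConf g.φ g.b i μ j ν t u =
    (decide (0 < varTab g.φ (i * g.B3 + t)) &&
      decide (varTab g.φ (i * g.B3 + t) = varTab g.φ (j * g.B3 + u)) &&
      !decide (μ >>> t &&& 1 = ν >>> u &&& 1)) := by
  rw [varTab_slot, varTab_slot, shiftRight_and_one, shiftRight_and_one, pairConf]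
  cases slotLit g.φ g.b i t <;> cases slotLit g.φ g.b j u <;> cases μ.testBit t <;>
    cases ν.testBit u <;> simp [beq_eq_decide]

/-- The frame of `conf`: registers `34–45`. [folklore] -/
def ConfFrame (m m' : ℕ → ℕ) : Prop := ∀ a, a < 34 ∨ 45 < a → m' a = m a

/-- The invariant of a row of `conf`. [folklore] -/
structure ConfRow (m : ℕ → ℕ) (i μ j ν t u : ℕ) (m' : ℕ → ℕ) : Prop where
  r34 : m' 34 = (confUpTo g.φ g.b i μ j ν t u).toNat
  r35 : m' 35 = t
  r36 : m' 36 = g.B3 - t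
  r37 : m' 37 = u
  r38 : m' 38 = g.B3 - u
  frame : ConfFrame m m'

/-- The invariant of the row loop of `conf`. [folklore] -/
structure ConfOut (m : ℕ → ℕ) (i μ j ν t : ℕ) (m' : ℕ → ℕ) : Prop where
  r34 : m' 34 = (confUpTo g.φ g.b i μ j ν t 0).toNat
  r35 : m' 35 = t
  r36 : m' 36 = g.B3 - t
  frame : ConfFrame m m'

/-- **The conflict subroutine.** With `r4 = 3b`, `r7 = V0`, the slot-variable table in place and
`(i, μ, j, ν)` in `r30–r33` (`i, j < K`), `conf` leaves `conflictB φ b i μ j ν` (as `0`/`1`) in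
`r34`, changing only `r34–r45`, within `3b (26 · 3b + 7) + 4` steps. [folklore] -/
theorem conf_spec (hF : g.Fits W) (hK : 2 ≤ g.K) {m : ℕ → ℕ} {i μ j ν : ℕ}
    (h4 : m 4 = g.B3) (h7 : m 7 = g.V0) (h30 : m 30 = i) (h31 : m 31 = μ) (h32 : m 32 = j)
    (h33 : m 33 = ν) (hi : i < g.K) (hj : j < g.K)
    (htab : ∀ s, s < g.B3 * g.K → m (g.V0 + s) = varTab g.φ s) :
    Achieves W O conf m
      (fun m' => m' 34 = (conflictB g.φ g.b i μ j ν).toNat ∧ ConfFrame m m')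
      (g.B3 * (26 * g.B3 + 7) + 4) := by
  obtain ⟨hX, hXLx, hV0, hP0, hOK0, hBv, hSv, htop, hNNV, hPwV, hcMV, hKN, hSN, hmLx, hB3, hmb,
    hNNN, h3m, hB3K, hPw1, hS1⟩ := g.facts hF hK
  have hiB : i * g.B3 + g.B3 ≤ g.B3 * g.K :=
    calc i * g.B3 + g.B3 = (i + 1) * g.B3 := (Nat.succ_mul _ _).symm
      _ ≤ g.K * g.B3 := Nat.mul_le_mul_right _ hi
      _ = g.B3 * g.K := Nat.mul_comm _ _
  have hjB : j * g.B3 + g.B3 ≤ g.B3 * g.K :=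
    calc j * g.B3 + g.B3 = (j + 1) * g.B3 := (Nat.succ_mul _ _).symm
      _ ≤ g.K * g.B3 := Nat.mul_le_mul_right _ hj
      _ = g.B3 * g.K := Nat.mul_comm _ _
  have hnv : g.φ.numVars < 2 ^ W := g.numVars_lt hF
  unfold conf
  refine Achieves.mono (T := 3 + (g.B3 * (26 * g.B3 + 5 + 2) + 1)) ?_
    (fun m' (h : g.ConfOut m i μ j ν g.B3 m') => ⟨?_, h.frame⟩) (by ring_nf; omega)
  swap
  · rw [h.r34, show g.B3 = 3 * g.b from rfl, confUpTo_done]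
  refine Achieves.seqs_cons (R := g.ConfOut m i μ j ν 0) (T₁ := 3) ?_ fun m₁ h₁ => ?_
  · refine achieves_block_of_eq (fun m' hm' => ?_) le_rfl
    simp (disch := first | omega | decide) only [execOps_cons, execOps_nil, execOp, Operand.write,
      Operand.read, merge_apply_of_lt, update_merge_of_lt, Function.update_of_ne, BinOp.eval_band,
      Nat.and_self, h4] at hm'
    subst hm'
    refine ⟨?_, ?_, ?_, fun a ha => ?_⟩
    · (try simp (disch := first | omega | decide) only [merge_apply_of_lt, Function.update_self,
      Function.update_of_ne]); rw [confUpTo_zero]; rfl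
    · (try simp (disch := first | omega | decide) only [merge_apply_of_lt, Function.update_self,
      Function.update_of_ne])
    · (try simp (disch := first | omega | decide) only [merge_apply_of_lt,
      Function.update_self]); omega
    · rcases lt_or_ge a 100 with h | h
      · rw [merge_apply_of_lt h]; simp (disch := omega) only [Function.update_of_ne]
      · rw [merge_apply_of_le h]
  refine Achieves.seqs_cons (T₂ := 0) ?_ (fun _ h => Achieves.seqs_nil h)
  refine Achieves.whilenz g.B3 (26 * g.B3 + 5) (fun t => g.ConfOut m i μ j ν t)
    (fun t ht m' hI => ⟨?_, ?_⟩) (fun m' hI => ?_) h₁ (fun _ h => h) le_rfl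
  · simp only [Operand.read, hI.r36]; omega
  swap
  · simp only [Operand.read, hI.r36]; omega
  -- one row
  obtain ⟨q34, q35, q36, qf⟩ := hI
  unfold confRow
  refine Achieves.mono (T := 2 + ((g.B3 * (24 + 2) + 1) + 2)) ?_ (fun _ h => h) (by omega)
  refine Achieves.seqs_cons (R := g.ConfRow m i μ j ν t 0) (T₁ := 2) ?_ fun m₂ h₂ => ?_
  · have f4 : m' 4 = g.B3 := (qf 4 (by omega)).trans h4
    refine achieves_block_of_eq (fun m'' hm'' => ?_) le_rfl
    simp (disch := first | omega | decide) only [execOps_cons, execOps_nil, execOp, Operand.write,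
      Operand.read, merge_apply_of_lt, update_merge_of_lt, Function.update_of_ne, BinOp.eval_band,
      Nat.and_self, f4] at hm''
    subst hm''
    refine ⟨?_, ?_, ?_, ?_, ?_, fun a ha => ?_⟩
    · (try simp (disch := first | omega | decide) only [merge_apply_of_lt,
      Function.update_of_ne]); exact q34
    · (try simp (disch := first | omega | decide) only [merge_apply_of_lt,
      Function.update_of_ne]); exact q35
    · (try simp (disch := first | omega | decide) only [merge_apply_of_lt,
      Function.update_of_ne]); exact q36
    · (try simp (disch := first | omega | decide) only [merge_apply_of_lt, Function.update_self,
      Function.update_of_ne])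
    · (try simp (disch := first | omega | decide) only [merge_apply_of_lt,
      Function.update_self]); omega
    · rcases lt_or_ge a 100 with h | h
      · rw [merge_apply_of_lt h]; simp (disch := omega) only [Function.update_of_ne]; exact qf a ha
      · rw [merge_apply_of_le h]; exact qf a ha
  refine Achieves.seqs_cons (R := g.ConfRow m i μ j ν t g.B3) (T₁ := g.B3 * (24 + 2) + 1) ?_
    fun m₃ h₃ => ?_
  · refine Achieves.whilenz g.B3 24 (fun u => g.ConfRow m i μ j ν t u)
      (fun u hu m'' hJ => ⟨?_, ?_⟩) (fun m'' hJ => ?_) h₂ (fun _ h => h) le_rfl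
    · simp only [Operand.read, hJ.r38]; omega
    swap
    · simp only [Operand.read, hJ.r38]; omega
    -- the body: one pair of slots
    obtain ⟨s34, s35, s36, s37, s38, sf⟩ := hJ
    have f4 : m'' 4 = g.B3 := (sf 4 (by omega)).trans h4
    have f7 : m'' 7 = g.V0 := (sf 7 (by omega)).trans h7
    have f30 : m'' 30 = i := (sf 30 (by omega)).trans h30
    have f31 : m'' 31 = μ := (sf 31 (by omega)).trans h31
    have f32 : m'' 32 = j := (sf 32 (by omega)).trans h32
    have f33 : m'' 33 = ν := (sf 33 (by omega)).trans h33
    have rd1 : m'' (g.V0 + (i * g.B3 + t)) = varTab g.φ (i * g.B3 + t) :=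
      (sf _ (by omega)).trans (htab _ (by omega))
    have rd2 : m'' (g.V0 + (j * g.B3 + u)) = varTab g.φ (j * g.B3 + u) :=
      (sf _ (by omega)).trans (htab _ (by omega))
    have hv1 := (g.varTab_le (i * g.B3 + t)).1
    have hv2 := (g.varTab_le (j * g.B3 + u)).1
    refine achieves_block_of_eq (fun m₄ hm₄ => ?_) le_rfl
    simp (disch := first | omega | decide) only [execOps_cons, execOps_nil, execOp, Operand.write,
      Operand.read, merge_apply_of_lt, merge_apply_of_le, update_merge_of_lt,
      Function.update_self, Function.update_of_ne, BinOp.eval_add_of_lt, BinOp.eval_sub_of_le,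
      BinOp.eval_mul_of_lt, BinOp.eval_band, BinOp.eval_shr, BinOp.eval_lt, BinOp.eval_eq,
      Nat.and_self, f4, f7, f30, f31, f32, f33, s34, s35, s37, s38, rd1, rd2] at hm₄
    subst hm₄
    refine ⟨?_, ?_, ?_, ?_, ?_, fun a ha => ?_⟩
    · (try simp (disch := first | omega | decide) only [merge_apply_of_lt, Function.update_self,
      Function.update_of_ne]); rw [conf_step,
        confUpTo_succ, pairConf_eq]
    · (try simp (disch := first | omega | decide) only [merge_apply_of_lt,
      Function.update_of_ne]); exact s35
    · (try simp (disch := first | omega | decide) only [merge_apply_of_lt,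
      Function.update_of_ne]); exact s36
    · (try simp (disch := first | omega | decide) only [merge_apply_of_lt, Function.update_self,
      Function.update_of_ne])
    · (try simp (disch := first | omega | decide) only [merge_apply_of_lt,
      Function.update_self]); omega
    · rcases lt_or_ge a 100 with h | h
      · rw [merge_apply_of_lt h]; simp (disch := omega) only [Function.update_of_ne]; exact sf a ha
      · rw [merge_apply_of_le h]; exact sf a ha
  -- close the row
  obtain ⟨s34, s35, s36, s37, s38, sf⟩ := h₃
  refine Achieves.seqs_cons (T₁ := 2) (T₂ := 0) ?_ (fun _ h => Achieves.seqs_nil h)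
  refine achieves_block_of_eq (fun m₄ hm₄ => ?_) le_rfl
  simp (disch := first | omega | decide) only [execOps_cons, execOps_nil, execOp, Operand.write,
    Operand.read, merge_apply_of_lt, update_merge_of_lt, Function.update_of_ne,
    BinOp.eval_add_of_lt, BinOp.eval_sub_of_le, s35, s36] at hm₄
  subst hm₄
  refine ⟨?_, ?_, ?_, fun a ha => ?_⟩
  · (try simp (disch := first | omega | decide) only [merge_apply_of_lt,
    Function.update_of_ne]); rw [s34,
      show g.B3 = 3 * g.b from rfl, confUpTo_row]
  · (try simp (disch := first | omega | decide) only [merge_apply_of_lt, Function.update_self,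
    Function.update_of_ne])
  · (try simp (disch := first | omega | decide) only [merge_apply_of_lt,
    Function.update_self]); omega
  · rcases lt_or_ge a 100 with h | h
    · rw [merge_apply_of_lt h]; simp (disch := omega) only [Function.update_of_ne]; exact sf a ha
    · rw [merge_apply_of_le h]; exact sf a ha

end Params

end CliqueRed

end Literature.Computability.FineGrained

namespace Literature.Computability.FineGrained

open Cryptography Cryptography.WordRAM Complexity Cryptography.WordRAM.SProg

namespace CliqueRed

/-! ### Partial goodness -/

/-- Clause `q` of block `i` is absent or satisfied by the mask `μ`. [folklore] -/
def clauseOK (φ : CNF ℕ) (b i μ q : ℕ) : Bool :=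
  !decide (i * b + q < φ.length) ||
    (List.range 3).any fun l => (slotLit φ b i (3 * q + l)).map Prod.snd == some (μ.testBit (3 * q + l))

/-- The first `q` clauses of block `i` are absent or satisfied. [folklore] -/
def goodUpTo (φ : CNF ℕ) (b i μ q : ℕ) : Bool :=
  (List.range q).all (clauseOK φ b i μ)

/-- One of the first `l` slots of clause `q` of block `i` is satisfied by the mask. [folklore] -/
def slotAny (φ : CNF ℕ) (b i μ q l : ℕ) : Bool :=
  (List.range l).any fun l' => (slotLit φ b i (3 * q + l')).map Prod.snd == some (μ.testBit (3 * q + l'))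

section Good

variable (φ : CNF ℕ) (b i μ : ℕ)

/-- No clause examined. [folklore] -/
theorem goodUpTo_zero : goodUpTo φ b i μ 0 = true := by simp [goodUpTo]

/-- One more clause. [folklore] -/
theorem goodUpTo_succ (q : ℕ) : goodUpTo φ b i μ (q + 1) = (goodUpTo φ b i μ q && clauseOK φ b i μ q) := by
  simp [goodUpTo, List.range_succ, List.all_append]

/-- All clauses: the goodness bit. [folklore] -/
theorem goodUpTo_done : goodUpTo φ b i μ b = goodB φ b i μ := by
  unfold goodUpTo goodB clauseOK; rfl

/-- No slot examined. [folklore] -/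
theorem slotAny_zero (q : ℕ) : slotAny φ b i μ q 0 = false := by simp [slotAny]

/-- One more slot. [folklore] -/
theorem slotAny_succ (q l : ℕ) : slotAny φ b i μ q (l + 1) =
    (slotAny φ b i μ q l || ((slotLit φ b i (3 * q + l)).map Prod.snd == some (μ.testBit (3 * q + l)))) := by
  simp [slotAny, List.range_succ, List.any_append]

/-- A clause is fine iff absent or with a satisfied slot among its three. [folklore] -/
theorem clauseOK_eq (q : ℕ) :
    clauseOK φ b i μ q = (!decide (i * b + q < φ.length) || slotAny φ b i μ q 3) := rfl

end Good

/-- Negation of a comparison bit, by `< 1`. [folklore] -/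
theorem not_bit (P : Prop) [Decidable P] :
    (if (if P then 1 else 0 : ℕ) < 1 then 1 else 0 : ℕ) = (!decide P).toNat := by
  by_cases h : P <;> simp [h]

/-- Disjunction of two bits, by `eq`/`band`/`lt`. [folklore] -/
theorem or_toNat (x d : Bool) :
    (if ((if x.toNat = 0 then 1 else 0) &&& (if d.toNat = 0 then 1 else 0)) < 1 then 1 else 0 : ℕ) =
      (x || d).toNat := by
  cases x <;> cases d <;> rfl

/-- Disjunction of a bit with the conjunction of two comparison bits. [folklore] -/
theorem or_toNat_bits (d : Bool) (a e : Prop) [Decidable a] [Decidable e] :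
    (if ((if d.toNat = 0 then 1 else 0) &&&
      (if ((if a then 1 else 0) &&& (if e then 1 else 0)) = 0 then 1 else 0)) < 1 then 1 else 0 : ℕ) =
      (d || (decide a && decide e)).toNat := by
  simp only [ite_and_ite]
  cases d <;> by_cases ha : a <;> by_cases he : e <;> simp [ha, he]

namespace Params

variable (g : Params) {W : ℕ} {O : List ℕ → List ℕ}

/-- **The slot-satisfaction bit as computed**: the slot carries a literal whose polarity is the
mask's bit. [folklore] -/
theorem slotSat_eq (i μ q l : ℕ) :
    (decide (0 < varTab g.φ (i * g.B3 + (q * 3 + l))) &&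
      decide (polTab g.φ (i * g.B3 + (q * 3 + l)) = μ >>> (q * 3 + l) &&& 1)) =
      ((slotLit g.φ g.b i (3 * q + l)).map Prod.snd == some (μ.testBit (3 * q + l))) := by
  rw [varTab_slot, polTab_slot, shiftRight_and_one, show q * 3 + l = 3 * q + l by ring]
  cases slotLit g.φ g.b i (3 * q + l) with
  | none => simp
  | some lit => cases h : lit.2 <;> cases μ.testBit (3 * q + l) <;> simp [h]

/-- The frame of `good`: registers `46–56`. [folklore] -/
def GoodFrame (m m' : ℕ → ℕ) : Prop := ∀ a, a < 46 ∨ 56 < a → m' a = m a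

/-- The invariant of the clause loop of `good`. [folklore] -/
structure GoodInv (m : ℕ → ℕ) (i μ q : ℕ) (m' : ℕ → ℕ) : Prop where
  r46 : m' 46 = (goodUpTo g.φ g.b i μ q).toNat
  r47 : m' 47 = q
  r48 : m' 48 = g.b - q
  frame : GoodFrame m m'

/-- The assertion inside the body of `good`, after `l` slots of clause `q`. [folklore] -/
structure GoodMid (m : ℕ → ℕ) (i μ q l : ℕ) (m' : ℕ → ℕ) : Prop where
  r46 : m' 46 = (goodUpTo g.φ g.b i μ q).toNat
  r47 : m' 47 = q
  r48 : m' 48 = g.b - q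
  r49 : m' 49 = (!decide (i * g.b + q < g.m)).toNat
  r50 : m' 50 = (slotAny g.φ g.b i μ q l).toNat
  frame : GoodFrame m m'

/-- **One slot of `good`.** [folklore] -/
theorem goodSlot_spec (hF : g.Fits W) (hK : 2 ≤ g.K) {m : ℕ → ℕ} {i μ : ℕ}
    (h4 : m 4 = g.B3) (h7 : m 7 = g.V0) (h8 : m 8 = g.P0) (h30 : m 30 = i) (h31 : m 31 = μ)
    (hi : i < g.K) (htab : ∀ s, s < g.B3 * g.K → m (g.V0 + s) = varTab g.φ s)
    (hpol : ∀ s, s < g.B3 * g.K → m (g.P0 + s) = polTab g.φ s) {q l : ℕ} (hq : q < g.b)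
    (hl : l < 3) {m' : ℕ → ℕ} (hM : g.GoodMid m i μ q l m') :
    Achieves W O (block (goodSlot l)) m' (g.GoodMid m i μ q (l + 1)) 17 := by
  obtain ⟨hX, hXLx, hV0, hP0, hOK0, hBv, hSv, htop, hNNV, hPwV, hcMV, hKN, hSN, hmLx, hB3, hmb,
    hNNN, h3m, hB3K, hPw1, hS1⟩ := g.facts hF hK
  have hiB : i * g.B3 + g.B3 ≤ g.B3 * g.K :=
    calc i * g.B3 + g.B3 = (i + 1) * g.B3 := (Nat.succ_mul _ _).symm
      _ ≤ g.K * g.B3 := Nat.mul_le_mul_right _ hi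
      _ = g.B3 * g.K := Nat.mul_comm _ _
  have hnv : g.φ.numVars < 2 ^ W := g.numVars_lt hF
  obtain ⟨q46, q47, q48, q49, q50, qf⟩ := hM
  have f4 : m' 4 = g.B3 := (qf 4 (by omega)).trans h4
  have f7 : m' 7 = g.V0 := (qf 7 (by omega)).trans h7
  have f8 : m' 8 = g.P0 := (qf 8 (by omega)).trans h8
  have f30 : m' 30 = i := (qf 30 (by omega)).trans h30
  have f31 : m' 31 = μ := (qf 31 (by omega)).trans h31
  have hs : i * g.B3 + (q * 3 + l) < g.B3 * g.K := by
    have : q * 3 + l < g.B3 := by omega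
    omega
  have rv : m' (g.V0 + (i * g.B3 + (q * 3 + l))) = varTab g.φ (i * g.B3 + (q * 3 + l)) :=
    (qf _ (by omega)).trans (htab _ hs)
  have rp : m' (g.P0 + (i * g.B3 + (q * 3 + l))) = polTab g.φ (i * g.B3 + (q * 3 + l)) :=
    (qf _ (by omega)).trans (hpol _ hs)
  have bv : varTab g.φ (i * g.B3 + (q * 3 + l)) ≤ g.φ.numVars := (g.varTab_le _).1
  have bp : polTab g.φ (i * g.B3 + (q * 3 + l)) ≤ 1 := (g.varTab_le _).2
  refine achieves_block_of_eq (fun m₄ hm₄ => ?_) le_rfl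
  simp (disch := first | omega | decide) only [execOps_cons, execOps_nil, execOp, Operand.write,
    Operand.read, merge_apply_of_lt, merge_apply_of_le, update_merge_of_lt, Function.update_self,
    Function.update_of_ne, BinOp.eval_add_of_lt, BinOp.eval_mul_of_lt, BinOp.eval_band,
    BinOp.eval_shr, BinOp.eval_lt, BinOp.eval_eq, Nat.and_self, goodSlot, f4, f7, f8, f30, f31,
    q47, q50, rv, rp] at hm₄
  subst hm₄
  refine ⟨?_, ?_, ?_, ?_, ?_, fun a ha => ?_⟩
  · (try simp (disch := first | omega | decide) only [merge_apply_of_lt,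
    Function.update_of_ne]); exact q46
  · (try simp (disch := first | omega | decide) only [merge_apply_of_lt,
    Function.update_of_ne]); exact q47
  · (try simp (disch := first | omega | decide) only [merge_apply_of_lt,
    Function.update_of_ne]); exact q48
  · (try simp (disch := first | omega | decide) only [merge_apply_of_lt,
    Function.update_of_ne]); exact q49
  · (try simp (disch := first | omega | decide) only [merge_apply_of_lt,
    Function.update_self]); rw [or_toNat_bits,
      slotSat_eq, slotAny_succ]
  · rcases lt_or_ge a 100 with h | h
    · rw [merge_apply_of_lt h]; simp (disch := omega) only [Function.update_of_ne]; exact qf a ha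
    · rw [merge_apply_of_le h]; exact qf a ha

/-- **One clause of `good`.** [folklore] -/
theorem goodBody_spec (hF : g.Fits W) (hK : 2 ≤ g.K) {m : ℕ → ℕ} {i μ : ℕ}
    (h2 : m 2 = g.m) (h3 : m 3 = g.b) (h4 : m 4 = g.B3) (h7 : m 7 = g.V0) (h8 : m 8 = g.P0)
    (h30 : m 30 = i) (h31 : m 31 = μ) (hi : i < g.K)
    (htab : ∀ s, s < g.B3 * g.K → m (g.V0 + s) = varTab g.φ s)
    (hpol : ∀ s, s < g.B3 * g.K → m (g.P0 + s) = polTab g.φ s) {q : ℕ} (hq : q < g.b)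
    {m' : ℕ → ℕ} (hI : g.GoodInv m i μ q m') : Achieves W O goodBody m' (g.GoodInv m i μ (q + 1)) 63 := by
  obtain ⟨hX, hXLx, hV0, hP0, hOK0, hBv, hSv, htop, hNNV, hPwV, hcMV, hKN, hSN, hmLx, hB3, hmb,
    hNNN, h3m, hB3K, hPw1, hS1⟩ := g.facts hF hK
  have hib : i * g.b + g.b ≤ g.b * g.K :=
    calc i * g.b + g.b = (i + 1) * g.b := (Nat.succ_mul _ _).symm
      _ ≤ g.K * g.b := Nat.mul_le_mul_right _ hi
      _ = g.b * g.K := Nat.mul_comm _ _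
  have hbK : g.b * g.K ≤ g.B3 * g.K := Nat.mul_le_mul_right _ (by omega)
  obtain ⟨q46, q47, q48, qf⟩ := hI
  have f2 : m' 2 = g.m := (qf 2 (by omega)).trans h2
  have f3 : m' 3 = g.b := (qf 3 (by omega)).trans h3
  have f30 : m' 30 = i := (qf 30 (by omega)).trans h30
  unfold goodBody
  refine Achieves.seqs_cons (R := g.GoodMid m i μ q 0) (T₁ := 5) (T₂ := 58) ?_ fun m₁ h₁ => ?_
  · refine achieves_block_of_eq (fun m₄ hm₄ => ?_) le_rfl
    simp (disch := first | omega | decide) only [execOps_cons, execOps_nil, execOp, Operand.write,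
      Operand.read, merge_apply_of_lt, update_merge_of_lt, Function.update_self,
      Function.update_of_ne, BinOp.eval_add_of_lt, BinOp.eval_mul_of_lt, BinOp.eval_band,
      BinOp.eval_lt, Nat.and_self, f2, f3, f30, q47] at hm₄
    subst hm₄
    refine ⟨?_, ?_, ?_, ?_, ?_, fun a ha => ?_⟩
    · (try simp (disch := first | omega | decide) only [merge_apply_of_lt,
      Function.update_of_ne]); exact q46
    · (try simp (disch := first | omega | decide) only [merge_apply_of_lt,
      Function.update_of_ne]); exact q47
    · (try simp (disch := first | omega | decide) only [merge_apply_of_lt,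
      Function.update_of_ne]); exact q48
    · (try simp (disch := first | omega | decide) only [merge_apply_of_lt, Function.update_self,
      Function.update_of_ne]); rw [not_bit]
    · (try simp (disch := first | omega | decide) only [merge_apply_of_lt,
      Function.update_self]); rw [slotAny_zero]; rfl
    · rcases lt_or_ge a 100 with h | h
      · rw [merge_apply_of_lt h]; simp (disch := omega) only [Function.update_of_ne]; exact qf a ha
      · rw [merge_apply_of_le h]; exact qf a ha
  refine Achieves.seqs_cons (R := g.GoodMid m i μ q 1) (T₁ := 17) (T₂ := 41)
    (g.goodSlot_spec hF hK h4 h7 h8 h30 h31 hi htab hpol hq (by norm_num) h₁) fun m₂ h₂ => ?_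
  refine Achieves.seqs_cons (R := g.GoodMid m i μ q 2) (T₁ := 17) (T₂ := 24)
    (g.goodSlot_spec hF hK h4 h7 h8 h30 h31 hi htab hpol hq (by norm_num) h₂) fun m₃ h₃ => ?_
  refine Achieves.seqs_cons (R := g.GoodMid m i μ q 3) (T₁ := 17) (T₂ := 7)
    (g.goodSlot_spec hF hK h4 h7 h8 h30 h31 hi htab hpol hq (by norm_num) h₃) fun m₄ h₄ => ?_
  obtain ⟨s46, s47, s48, s49, s50, sf⟩ := h₄
  refine Achieves.seqs_cons (T₁ := 7) (T₂ := 0) ?_ (fun _ h => Achieves.seqs_nil h)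
  refine achieves_block_of_eq (fun m₅ hm₅ => ?_) le_rfl
  simp (disch := first | omega | decide) only [execOps_cons, execOps_nil, execOp, Operand.write,
    Operand.read, merge_apply_of_lt, update_merge_of_lt, Function.update_self,
    Function.update_of_ne, BinOp.eval_add_of_lt, BinOp.eval_sub_of_le, BinOp.eval_band,
    BinOp.eval_lt, BinOp.eval_eq, s46, s47, s48, s49, s50] at hm₅
  subst hm₅
  refine ⟨?_, ?_, ?_, fun a ha => ?_⟩
  · (try simp (disch := first | omega | decide) only [merge_apply_of_lt, Function.update_self,
    Function.update_of_ne]); rw [or_toNat,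
      toNat_and_toNat, goodUpTo_succ, clauseOK_eq]; rfl
  · (try simp (disch := first | omega | decide) only [merge_apply_of_lt, Function.update_self,
    Function.update_of_ne])
  · (try simp (disch := first | omega | decide) only [merge_apply_of_lt,
    Function.update_self]); omega
  · rcases lt_or_ge a 100 with h | h
    · rw [merge_apply_of_lt h]; simp (disch := omega) only [Function.update_of_ne]; exact sf a ha
    · rw [merge_apply_of_le h]; exact sf a ha

/-- **The goodness subroutine.** With `r2 = m`, `r3 = b`, `r4 = 3b`, `r7 = V0`, `r8 = P0`, both
tables in place and `(i, μ)` in `r30, r31` (`i < K`), `good` leaves `goodB φ b i μ` in `r46`,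
changing only `r46–r56`, within `65 b + 4` steps. [folklore] -/
theorem good_spec (hF : g.Fits W) (hK : 2 ≤ g.K) {m : ℕ → ℕ} {i μ : ℕ}
    (h2 : m 2 = g.m) (h3 : m 3 = g.b) (h4 : m 4 = g.B3) (h7 : m 7 = g.V0) (h8 : m 8 = g.P0)
    (h30 : m 30 = i) (h31 : m 31 = μ) (hi : i < g.K)
    (htab : ∀ s, s < g.B3 * g.K → m (g.V0 + s) = varTab g.φ s)
    (hpol : ∀ s, s < g.B3 * g.K → m (g.P0 + s) = polTab g.φ s) :
    Achieves W O good m (fun m' => m' 46 = (goodB g.φ g.b i μ).toNat ∧ GoodFrame m m')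
      (g.b * 65 + 4) := by
  unfold good
  refine Achieves.mono (T := 3 + (g.b * (63 + 2) + 1)) ?_
    (fun m' (h : g.GoodInv m i μ g.b m') => ⟨?_, h.frame⟩) (by omega)
  swap
  · rw [h.r46, goodUpTo_done]
  refine Achieves.seqs_cons (R := g.GoodInv m i μ 0) (T₁ := 3) ?_ fun m₁ h₁ => ?_
  · refine achieves_block_of_eq (fun m' hm' => ?_) le_rfl
    simp (disch := first | omega | decide) only [execOps_cons, execOps_nil, execOp, Operand.write,
      Operand.read, merge_apply_of_lt, update_merge_of_lt, Function.update_of_ne, BinOp.eval_band,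
      Nat.and_self, h3] at hm'
    subst hm'
    refine ⟨?_, ?_, ?_, fun a ha => ?_⟩
    · (try simp (disch := first | omega | decide) only [merge_apply_of_lt, Function.update_self,
      Function.update_of_ne]); rw [goodUpTo_zero]; rfl
    · (try simp (disch := first | omega | decide) only [merge_apply_of_lt, Function.update_self,
      Function.update_of_ne])
    · (try simp (disch := first | omega | decide) only [merge_apply_of_lt,
      Function.update_self]); omega
    · rcases lt_or_ge a 100 with h | h
      · rw [merge_apply_of_lt h]; simp (disch := omega) only [Function.update_of_ne]
      · rw [merge_apply_of_le h]
  refine Achieves.seqs_cons (T₂ := 0) ?_ (fun _ h => Achieves.seqs_nil h)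
  refine Achieves.whilenz g.b 63 (fun q => g.GoodInv m i μ q)
    (fun q hq m' hI => ⟨?_, g.goodBody_spec hF hK h2 h3 h4 h7 h8 h30 h31 hi htab hpol hq hI⟩)
    (fun m' hI => ?_) h₁ (fun _ h => h) le_rfl
  · simp only [Operand.read, hI.r48]; omega
  · simp only [Operand.read, hI.r48]; omega

end Params

end CliqueRed

end Literature.Computability.FineGrained

namespace Literature.Computability.FineGrained

open Cryptography Cryptography.WordRAM Complexity Cryptography.WordRAM.SProg

namespace CliqueRed

/-- The adjacency bit in terms of the vertex-table bits. [folklore] -/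
theorem adjB_eq (φ : CNF ℕ) (b S a a' : ℕ) : adjB φ b S a a' =
    (!conflictB φ b (a / S) (a % S) (a' / S) (a' % S) && !decide (a / S = a' / S) &&
      (!conflictB φ b (a / S) (a % S) (a / S) (a % S) && goodB φ b (a / S) (a % S)) &&
      (!conflictB φ b (a' / S) (a' % S) (a' / S) (a' % S) && goodB φ b (a' / S) (a' % S))) := by
  unfold adjB
  cases conflictB φ b (a / S) (a % S) (a' / S) (a' % S) <;>
    cases conflictB φ b (a / S) (a % S) (a / S) (a % S) <;>
    cases conflictB φ b (a' / S) (a' % S) (a' / S) (a' % S) <;>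
    cases goodB φ b (a / S) (a % S) <;> cases goodB φ b (a' / S) (a' % S) <;>
    by_cases h : a / S = a' / S <;> simp [h]

namespace Params

variable (g : Params) {W : ℕ} {O : List ℕ → List ℕ}

/-! ### Reading and stepping the vertex-table and matrix data -/

/-- The tables inside `okData`. [folklore] -/
theorem okData_tab (p : ℕ) {s : ℕ} (hs : s < g.B3 * g.K) :
    g.okData p (g.V0 + s) = varTab g.φ s ∧ g.okData p (g.P0 + s) = polTab g.φ s := by
  obtain ⟨hX, hV0, hP0, hOK0, -⟩ := g.bases
  unfold okData
  rw [if_neg (by omega), if_pos (by omega), Nat.add_sub_cancel_left, if_neg (by omega),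
    if_neg (by omega), if_pos (by omega), Nat.add_sub_cancel_left]
  exact ⟨rfl, rfl⟩

/-- The tables and the vertex table inside `matData`. [folklore] -/
theorem matData_tab (p : ℕ) {s : ℕ} (hs : s < g.B3 * g.K) :
    g.matData p (g.V0 + s) = varTab g.φ s ∧ g.matData p (g.P0 + s) = polTab g.φ s := by
  obtain ⟨hX, hV0, hP0, hOK0, -⟩ := g.bases
  unfold matData
  rw [if_neg (by omega), if_pos (by omega), Nat.add_sub_cancel_left, if_neg (by omega),
    if_neg (by omega), if_pos (by omega), Nat.add_sub_cancel_left]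
  exact ⟨rfl, rfl⟩

/-- The vertex table inside `matData`. [folklore] -/
theorem matData_ok (p : ℕ) {a : ℕ} (ha : a < g.N) : g.matData p (g.OK0 + a) = g.okVal a := by
  obtain ⟨hX, hV0, hP0, hOK0, hBv, -⟩ := g.bases
  unfold matData
  rw [if_neg (by omega), if_neg (by omega), if_neg (by omega), if_pos (by omega),
    Nat.add_sub_cancel_left]

/-- Stage `0` of the vertex table is the end of the tables. [folklore] -/
theorem okData_zero (hK : 0 < g.K) (a : ℕ) : g.okData 0 a = g.tabData (3 * g.m) a := by
  have hmb : g.m ≤ g.b * g.K := g.m_le hK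
  have hempty : ∀ s, 3 * g.m ≤ s → varTab g.φ s = 0 ∧ polTab g.φ s = 0 := fun s hs => by
    unfold varTab polTab; rw [litAt_of_le (by unfold m at hs; omega)]; exact ⟨rfl, rfl⟩
  unfold okData tabData
  by_cases h1 : a < g.V0
  · rw [if_pos h1, if_pos h1]
  rw [if_neg h1, if_neg h1]
  by_cases h2 : a < g.P0
  · rw [if_pos h2, if_pos h2]
    by_cases h3 : a - g.V0 < 3 * g.m
    · rw [if_pos h3]
    · rw [if_neg h3, (hempty _ (not_lt.1 h3)).1]
  rw [if_neg h2, if_neg h2]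
  by_cases h4 : a < g.OK0
  · rw [if_pos h4, if_pos h4]
    by_cases h3 : a - g.P0 < 3 * g.m
    · rw [if_pos h3]
    · rw [if_neg h3, (hempty _ (not_lt.1 h3)).2]
  rw [if_neg h4, if_neg h4]
  split_ifs <;> first | rfl | omega

/-- **One vertex written.** [folklore] -/
theorem okData_succ {p : ℕ} (hp : p < g.N) {m : ℕ → ℕ} (hm : ∀ a, 100 ≤ a → m a = g.okData p a)
    (a : ℕ) (ha : 100 ≤ a) :
    Function.update m (g.OK0 + p) (g.okVal p) a = g.okData (p + 1) a := by
  obtain ⟨hX, hV0, hP0, hOK0, hBv, -⟩ := g.bases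
  by_cases h1 : a = g.OK0 + p
  · subst h1; rw [Function.update_self]; unfold okData
    rw [if_neg (by omega), if_neg (by omega), if_neg (by omega), if_pos (by omega),
      if_pos (by omega), Nat.add_sub_cancel_left]
  rw [Function.update_of_ne h1, hm a ha]
  unfold okData
  by_cases h3 : a < g.V0
  · rw [if_pos h3, if_pos h3]
  rw [if_neg h3, if_neg h3]
  by_cases h4 : a < g.P0
  · rw [if_pos h4, if_pos h4]
  rw [if_neg h4, if_neg h4]
  by_cases h5 : a < g.OK0
  · rw [if_pos h5, if_pos h5]
  rw [if_neg h5, if_neg h5]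
  by_cases h6 : a < g.Bv
  · rw [if_pos h6, if_pos h6]
    have : (a - g.OK0 < p) ↔ (a - g.OK0 < p + 1) := by omega
    simp only [this]
  rw [if_neg h6, if_neg h6]

/-- Stage `0` of the matrix is the end of the vertex table. [folklore] -/
theorem matData_zero (a : ℕ) : g.matData 0 a = g.okData g.N a := by
  obtain ⟨hX, hV0, hP0, hOK0, hBv, -⟩ := g.bases
  unfold matData okData
  by_cases h1 : a < g.V0
  · rw [if_pos h1, if_pos h1]
  rw [if_neg h1, if_neg h1]
  by_cases h2 : a < g.P0
  · rw [if_pos h2, if_pos h2]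
  rw [if_neg h2, if_neg h2]
  by_cases h4 : a < g.OK0
  · rw [if_pos h4, if_pos h4]
  rw [if_neg h4, if_neg h4]
  by_cases h5 : a < g.Bv
  · rw [if_pos h5, if_pos h5, if_pos (by omega)]
  rw [if_neg h5, if_neg h5]
  split_ifs <;> first | rfl | omega

/-- **One entry written.** [folklore] -/
theorem matData_succ {q : ℕ} {m : ℕ → ℕ}
    (hm : ∀ a, 100 ≤ a → m a = g.matData q a) (a : ℕ) (ha : 100 ≤ a) :
    Function.update m (g.Bv + (q + 3)) (g.adjVal (q / g.N) (q % g.N)) a = g.matData (q + 1) a := by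
  obtain ⟨hX, hV0, hP0, hOK0, hBv, -⟩ := g.bases
  by_cases h1 : a = g.Bv + (q + 3)
  · subst h1; rw [Function.update_self]; unfold matData
    rw [if_neg (by omega), if_neg (by omega), if_neg (by omega), if_neg (by omega),
      if_neg (by omega), if_pos (by omega), show g.Bv + (q + 3) - (g.Bv + 3) = q by omega]
  rw [Function.update_of_ne h1, hm a ha]
  unfold matData
  by_cases h3 : a < g.V0
  · rw [if_pos h3, if_pos h3]
  rw [if_neg h3, if_neg h3]
  by_cases h4 : a < g.P0
  · rw [if_pos h4, if_pos h4]
  rw [if_neg h4, if_neg h4]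
  by_cases h5 : a < g.OK0
  · rw [if_pos h5, if_pos h5]
  rw [if_neg h5, if_neg h5]
  by_cases h6 : a < g.Bv
  · rw [if_pos h6, if_pos h6]
  rw [if_neg h6, if_neg h6]
  by_cases h7 : a < g.Bv + 3
  · rw [if_pos h7, if_pos h7]
  rw [if_neg h7, if_neg h7]
  have : (a - (g.Bv + 3) < q) ↔ (a - (g.Bv + 3) < q + 1) := by omega
  simp only [this]

/-- `p / S < K` for `p < N`. [folklore] -/
theorem div_S_lt {p : ℕ} (hp : p < g.N) : p / g.S < g.K :=
  Nat.div_lt_of_lt_mul (by unfold N at hp; rw [Nat.mul_comm]; exact hp)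

/-- The time of `conf`. [folklore] -/
def Tconf : ℕ := g.B3 * (26 * g.B3 + 7) + 4
/-- The time of `good`. [folklore] -/
def Tgood : ℕ := g.b * 65 + 4
/-- The time of one vertex of the vertex table. [folklore] -/
def Tok : ℕ := g.Tconf + g.Tgood + 10
/-- The time of one entry of the matrix. [folklore] -/
def Tentry : ℕ := g.Tconf + 23
/-- The time of one row of the matrix. [folklore] -/
def Trow : ℕ := g.N * (g.Tentry + 2) + 5

/-! ### The vertex table -/

/-- The invariant of the vertex-table loop. [folklore] -/
structure OkInv (p : ℕ) (m : ℕ → ℕ) : Prop where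
  regs : g.Regs m
  eregs : g.ERegs m
  r60 : m 60 = p
  r61 : m 61 = g.N - p
  data : ∀ a, 100 ≤ a → m a = g.okData p a

/-- **One vertex.** [folklore] -/
theorem okBody_spec (hF : g.Fits W) (hK : 2 ≤ g.K) {p : ℕ} (hp : p < g.N) {m : ℕ → ℕ}
    (hI : g.OkInv p m) : Achieves W O okBody m (g.OkInv (p + 1)) g.Tok := by
  obtain ⟨hX, hXLx, hV0, hP0, hOK0, hBv, hSv, htop, hNNV, hPwV, hcMV, hKN, hSN, hmLx, hB3, hmb,
    hNNN, h3m, hB3K, hPw1, hS1⟩ := g.facts hF hK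
  obtain ⟨hR, hE, r60, r61, hD⟩ := hI
  have hiK : p / g.S < g.K := g.div_S_lt hp
  unfold okBody Tok
  refine Achieves.mono (T := 4 + (g.Tconf + (1 + (g.Tgood + (5 + 0))))) ?_ (fun _ h => h) (by omega)
  -- block A
  refine Achieves.seqs_cons (R := fun m₁ => m₁ 30 = p / g.S ∧ m₁ 31 = p % g.S ∧
      m₁ 32 = p / g.S ∧ m₁ 33 = p % g.S ∧ ∀ a, a < 30 ∨ 33 < a → m₁ a = m a) ?_ fun m₁ h₁ => ?_
  · have r5 := hR.r5
    refine achieves_block_of_eq (fun m' hm' => ?_) le_rfl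
    simp (disch := first | omega | decide) only [execOps_cons, execOps_nil, execOp, Operand.write,
      Operand.read, merge_apply_of_lt, update_merge_of_lt, Function.update_self,
      Function.update_of_ne, BinOp.eval_div, BinOp.eval_mod, BinOp.eval_band, Nat.and_self, r5,
      r60] at hm'
    subst hm'
    refine ⟨?_, ?_, ?_, ?_, fun a ha => ?_⟩
    · (try simp (disch := first | omega | decide) only [merge_apply_of_lt, Function.update_self,
      Function.update_of_ne])
    · (try simp (disch := first | omega | decide) only [merge_apply_of_lt, Function.update_self,
      Function.update_of_ne])
    · (try simp (disch := first | omega | decide) only [merge_apply_of_lt, Function.update_self,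
      Function.update_of_ne])
    · (try simp (disch := first | omega | decide) only [merge_apply_of_lt, Function.update_self])
    · rcases lt_or_ge a 100 with h | h
      · rw [merge_apply_of_lt h]; simp (disch := omega) only [Function.update_of_ne]
      · rw [merge_apply_of_le h]
  obtain ⟨q30, q31, q32, q33, qf⟩ := h₁
  -- conf
  have q4 : m₁ 4 = g.B3 := (qf 4 (by omega)).trans hR.r4
  have q7 : m₁ 7 = g.V0 := (qf 7 (by omega)).trans hR.r7
  have qtab : ∀ s, s < g.B3 * g.K → m₁ (g.V0 + s) = varTab g.φ s := fun s hs => by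
    rw [qf _ (by omega), hD _ (by omega), (g.okData_tab p hs).1]
  refine Achieves.seqs_cons (g.conf_spec hF hK q4 q7 q30 q31 q32 q33 hiK hiK qtab) fun m₂ ⟨c34,
  cf⟩ => ?_
  -- block B
  refine Achieves.seqs_cons (R := fun m₃ =>
      m₃ 62 = (!conflictB g.φ g.b (p / g.S) (p % g.S) (p / g.S) (p % g.S)).toNat ∧
      ∀ a, a ≠ 62 → m₃ a = m₂ a) ?_ fun m₃ ⟨d62, df⟩ => ?_
  · refine achieves_block_of_eq (fun m' hm' => ?_) le_rfl
    simp (disch := first | omega | decide) only [execOps_cons, execOps_nil, execOp, Operand.write,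
      Operand.read, merge_apply_of_lt, update_merge_of_lt, BinOp.eval_lt, c34] at hm'
    subst hm'
    refine ⟨?_, fun a ha => ?_⟩
    · (try simp (disch := first | omega | decide) only [merge_apply_of_lt,
      Function.update_self]); rw [ite_toNat_lt_one]
    · rcases lt_or_ge a 100 with h | h
      · rw [merge_apply_of_lt h]; simp (disch := omega) only [Function.update_of_ne]
      · rw [merge_apply_of_le h]
  -- good
  have back₃ : ∀ a, a < 34 ∨ (45 < a ∧ a ≠ 62) → m₃ a = m₁ a := fun a ha => by
    rw [df a (by omega), cf a (by omega)]
  have s2 : m₃ 2 = g.m := by rw [back₃ 2 (by omega), qf 2 (by omega), hR.r2]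
  have s3 : m₃ 3 = g.b := by rw [back₃ 3 (by omega), qf 3 (by omega), hR.r3]
  have s4 : m₃ 4 = g.B3 := by rw [back₃ 4 (by omega), q4]
  have s7 : m₃ 7 = g.V0 := by rw [back₃ 7 (by omega), q7]
  have s8 : m₃ 8 = g.P0 := by rw [back₃ 8 (by omega), qf 8 (by omega), hR.r8]
  have s30 : m₃ 30 = p / g.S := by rw [back₃ 30 (by omega), q30]
  have s31 : m₃ 31 = p % g.S := by rw [back₃ 31 (by omega), q31]
  have stab : ∀ s, s < g.B3 * g.K → m₃ (g.V0 + s) = varTab g.φ s := fun s hs => by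
    rw [back₃ _ (by omega), qtab s hs]
  have spol : ∀ s, s < g.B3 * g.K → m₃ (g.P0 + s) = polTab g.φ s := fun s hs => by
    rw [back₃ _ (by omega), qf _ (by omega), hD _ (by omega), (g.okData_tab p hs).2]
  refine Achieves.seqs_cons (g.good_spec hF hK s2 s3 s4 s7 s8 s30 s31 hiK stab spol)
    fun m₄ ⟨e46, ef⟩ => ?_
  -- block C
  have back₄ : ∀ a, a < 30 ∨ (56 < a ∧ a ≠ 62) → m₄ a = m a := fun a ha => by
    rw [ef a (by omega), df a (by omega), cf a (by omega), qf a (by omega)]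
  have t9 : m₄ 9 = g.OK0 := by rw [back₄ 9 (by omega), hR.r9]
  have t60 : m₄ 60 = p := by rw [back₄ 60 (by omega), r60]
  have t61 : m₄ 61 = g.N - p := by rw [back₄ 61 (by omega), r61]
  have t62 : m₄ 62 = (!conflictB g.φ g.b (p / g.S) (p % g.S) (p / g.S) (p % g.S)).toNat := by
    rw [ef 62 (by omega), d62]
  have tD : ∀ a, 100 ≤ a → m₄ a = g.okData p a := fun a ha => by rw [back₄ a (by omega), hD a ha]
  refine Achieves.seqs_cons (T₂ := 0) ?_ (fun _ h => Achieves.seqs_nil h)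
  refine achieves_block_of_eq (fun m' hm' => ?_) le_rfl
  simp (disch := first | omega | decide) only [execOps_cons, execOps_nil, execOp, Operand.write,
    Operand.read, merge_apply_of_lt, update_merge_of_lt, update_merge_of_le, Function.update_self,
    Function.update_of_ne, BinOp.eval_add_of_lt, BinOp.eval_sub_of_le, BinOp.eval_band,
    Nat.and_self, t9, t60, t61, t62, e46, toNat_and_toNat] at hm'
  subst hm'
  have hR' : g.Regs m₄ := hR.of_frame fun a ha => back₄ a (by omega)
  have hE' : g.ERegs m₄ := hE.of_frame fun a ha _ => back₄ a (by omega)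
  refine ⟨hR'.of_frame fun a ha => ?_, hE'.of_frame fun a ha ha' => ?_, ?_, ?_, fun a ha => ?data⟩
  case data =>
    (try simp (disch := first | omega | decide) only [merge_apply_of_le])
    exact g.okData_succ hp tD a ha
  · rw [merge_apply_of_lt (by omega)]; simp (disch := omega) only [Function.update_of_ne]
  · rw [merge_apply_of_lt (by omega)]; simp (disch := omega) only [Function.update_of_ne]
  · (try simp (disch := first | omega | decide) only [merge_apply_of_lt, Function.update_self,
    Function.update_of_ne])
  · (try simp (disch := first | omega | decide) only [merge_apply_of_lt,
    Function.update_self]); omega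

/-- **The vertex table.** [folklore] -/
theorem okTable_spec (hF : g.Fits W) (hK : 2 ≤ g.K) {m : ℕ → ℕ} (hT : g.TabOut g.m m) :
    Achieves W O okTable m (g.OkInv g.N) (g.N * (g.Tok + 2) + 3) := by
  obtain ⟨hX, hXLx, hV0, hP0, hOK0, hBv, hSv, htop, hNNV, hPwV, hcMV, hKN, hSN, hmLx, hB3, hmb,
    hNNN, h3m, hB3K, hPw1, hS1⟩ := g.facts hF hK
  obtain ⟨hR, hE, -, -, -, hD⟩ := hT
  unfold okTable
  refine Achieves.mono (T := 2 + ((g.N * (g.Tok + 2) + 1) + 0)) ?_ (fun _ h => h) (by omega)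
  refine Achieves.seqs_cons (R := g.OkInv 0) ?_ fun m₁ h₁ => ?_
  · have r6 := hR.r6
    refine achieves_block_of_eq (fun m' hm' => ?_) le_rfl
    simp (disch := first | omega | decide) only [execOps_cons, execOps_nil, execOp, Operand.write,
      Operand.read, merge_apply_of_lt, update_merge_of_lt, Function.update_of_ne, BinOp.eval_band,
      Nat.and_self, r6] at hm'
    subst hm'
    refine ⟨hR.of_frame fun a ha => ?_, hE.of_frame fun a ha ha' => ?_, ?_, ?_, fun a ha => ?data⟩
    case data => (try simp (disch := first | omega | decide) only [merge_apply_of_le]); rw [hD a ha, g.okData_zero (by omega)]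
    · rw [merge_apply_of_lt (by omega)]; simp (disch := omega) only [Function.update_of_ne]
    · rw [merge_apply_of_lt (by omega)]; simp (disch := omega) only [Function.update_of_ne]
    · (try simp (disch := first | omega | decide) only [merge_apply_of_lt, Function.update_self,
      Function.update_of_ne])
    · (try simp (disch := first | omega | decide) only [merge_apply_of_lt,
      Function.update_self]); omega
  refine Achieves.seqs_cons ?_ (fun _ h => Achieves.seqs_nil h)
  refine Achieves.whilenz g.N g.Tok (fun p => g.OkInv p)
    (fun p hp m' hI => ⟨?_, g.okBody_spec hF hK hp hI⟩) (fun m' hI => ?_) h₁ (fun _ h => h) le_rfl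
  · simp only [Operand.read, hI.r61]; omega
  · simp only [Operand.read, hI.r61]; omega

/-! ### The adjacency matrix -/

/-- The invariant of the entry loop of row `a`. [folklore] -/
structure EntryInv (a p : ℕ) (m : ℕ → ℕ) : Prop where
  regs : g.Regs m
  eregs : g.ERegs m
  r60 : m 60 = a
  r61 : m 61 = g.N - a
  r63 : m 63 = p
  r64 : m 64 = g.N - p
  data : ∀ c, 100 ≤ c → m c = g.matData (a * g.N + p) c

/-- The invariant of the row loop. [folklore] -/
structure RowInv (a : ℕ) (m : ℕ → ℕ) : Prop where
  regs : g.Regs m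
  eregs : g.ERegs m
  r60 : m 60 = a
  r61 : m 61 = g.N - a
  data : ∀ c, 100 ≤ c → m c = g.matData (a * g.N) c

/-- **One entry.** [folklore] -/
theorem matEntry_spec (hF : g.Fits W) (hK : 2 ≤ g.K) {a p : ℕ} (ha : a < g.N) (hp : p < g.N)
    {m : ℕ → ℕ} (hI : g.EntryInv a p m) : Achieves W O matEntry m (g.EntryInv a (p + 1)) g.Tentry := by
  obtain ⟨hX, hXLx, hV0, hP0, hOK0, hBv, hSv, htop, hNNV, hPwV, hcMV, hKN, hSN, hmLx, hB3, hmb,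
    hNNN, h3m, hB3K, hPw1, hS1⟩ := g.facts hF hK
  obtain ⟨hR, hE, r60, r61, r63, r64, hD⟩ := hI
  have hiK : a / g.S < g.K := g.div_S_lt ha
  have hjK : p / g.S < g.K := g.div_S_lt hp
  have haN : a * g.N + g.N ≤ g.N * g.N :=
    calc a * g.N + g.N = (a + 1) * g.N := (Nat.succ_mul _ _).symm
      _ ≤ g.N * g.N := Nat.mul_le_mul_right _ ha
  unfold matEntry Tentry
  refine Achieves.mono (T := 4 + (g.Tconf + (18 + 0))) ?_ (fun _ h => h) (by omega)
  -- block A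
  refine Achieves.seqs_cons (R := fun m₁ => m₁ 30 = a / g.S ∧ m₁ 31 = a % g.S ∧
      m₁ 32 = p / g.S ∧ m₁ 33 = p % g.S ∧ ∀ c, c < 30 ∨ 33 < c → m₁ c = m c) ?_ fun m₁ h₁ => ?_
  · have r5 := hR.r5
    refine achieves_block_of_eq (fun m' hm' => ?_) le_rfl
    simp (disch := first | omega | decide) only [execOps_cons, execOps_nil, execOp, Operand.write,
      Operand.read, merge_apply_of_lt, update_merge_of_lt, Function.update_of_ne, BinOp.eval_div,
      BinOp.eval_mod, r5, r60, r63] at hm'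
    subst hm'
    refine ⟨?_, ?_, ?_, ?_, fun c hc => ?_⟩
    · (try simp (disch := first | omega | decide) only [merge_apply_of_lt, Function.update_self,
      Function.update_of_ne])
    · (try simp (disch := first | omega | decide) only [merge_apply_of_lt, Function.update_self,
      Function.update_of_ne])
    · (try simp (disch := first | omega | decide) only [merge_apply_of_lt, Function.update_self,
      Function.update_of_ne])
    · (try simp (disch := first | omega | decide) only [merge_apply_of_lt, Function.update_self])
    · rcases lt_or_ge c 100 with h | h
      · rw [merge_apply_of_lt h]; simp (disch := omega) only [Function.update_of_ne]
      · rw [merge_apply_of_le h]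
  obtain ⟨q30, q31, q32, q33, qf⟩ := h₁
  -- conf
  have q4 : m₁ 4 = g.B3 := (qf 4 (by omega)).trans hR.r4
  have q7 : m₁ 7 = g.V0 := (qf 7 (by omega)).trans hR.r7
  have qtab : ∀ s, s < g.B3 * g.K → m₁ (g.V0 + s) = varTab g.φ s := fun s hs => by
    rw [qf _ (by omega), hD _ (by omega), (g.matData_tab _ hs).1]
  refine Achieves.seqs_cons (g.conf_spec hF hK q4 q7 q30 q31 q32 q33 hiK hjK qtab) fun m₂ ⟨c34,
  cf⟩ => ?_
  -- block B
  have back : ∀ c, c < 30 ∨ 45 < c → m₂ c = m c := fun c hc => by rw [cf c (by omega),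
  qf c (by omega)]
  have s6 : m₂ 6 = g.N := by rw [back 6 (by omega), hR.r6]
  have s9 : m₂ 9 = g.OK0 := by rw [back 9 (by omega), hR.r9]
  have s10 : m₂ 10 = g.Bv := by rw [back 10 (by omega), hR.r10]
  have s13 : m₂ 13 = g.Pw := by rw [back 13 (by omega), hE.r13]
  have s30 : m₂ 30 = a / g.S := by rw [cf 30 (by omega), q30]
  have s32 : m₂ 32 = p / g.S := by rw [cf 32 (by omega), q32]
  have s60 : m₂ 60 = a := by rw [back 60 (by omega), r60]
  have s63 : m₂ 63 = p := by rw [back 63 (by omega), r63]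
  have s64 : m₂ 64 = g.N - p := by rw [back 64 (by omega), r64]
  have oka : m₂ (g.OK0 + a) = g.okVal a := by rw [back _ (by omega), hD _ (by omega),
  g.matData_ok _ ha]
  have okp : m₂ (g.OK0 + p) = g.okVal p := by rw [back _ (by omega), hD _ (by omega),
  g.matData_ok _ hp]
  have sD : ∀ c,
  100 ≤ c → m₂ c = g.matData (a * g.N + p) c := fun c hc => by rw [back c (by omega), hD c hc]
  refine Achieves.seqs_cons (T₂ := 0) ?_ (fun _ h => Achieves.seqs_nil h)
  refine achieves_block_of_eq (fun m' hm' => ?_) le_rfl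
  simp (disch := first | omega | decide) only [execOps_cons, execOps_nil, execOp, Operand.write,
    Operand.read, merge_apply_of_lt, merge_apply_of_le, update_merge_of_lt, update_merge_of_le,
    Function.update_self, Function.update_of_ne, BinOp.eval_add_of_lt, BinOp.eval_sub_of_le,
    BinOp.eval_mul_of_lt, BinOp.eval_mod, BinOp.eval_band, BinOp.eval_lt, BinOp.eval_eq,
    Nat.and_self, c34, s6, s9, s10, s13, s30, s32, s60, s63, s64, oka, okp] at hm'
  subst hm'
  have hR' : g.Regs m₂ := hR.of_frame fun c hc => back c (by omega)
  have hE' : g.ERegs m₂ := hE.of_frame fun c hc _ => back c (by omega)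
  have hval : ((if (conflictB g.φ g.b (a / g.S) (a % g.S) (p / g.S) (p % g.S)).toNat < 1 then 1 else 0) &&&
      (if (if a / g.S = p / g.S then 1 else 0) < 1 then 1 else 0) &&& g.okVal a &&& g.okVal p) % g.Pw =
      g.adjVal ((a * g.N + p) / g.N) ((a * g.N + p) % g.N) := by
    have hN0 : 0 < g.N := by omega
    rw [Nat.mul_comm a, Nat.mul_add_div hN0, Nat.div_eq_of_lt hp, Nat.add_zero, Nat.mul_add_mod,
      Nat.mod_eq_of_lt hp, ite_toNat_lt_one, not_bit]
    unfold adjVal okVal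
    rw [toNat_and_toNat, toNat_and_toNat, toNat_and_toNat, adjB_eq]
  refine ⟨hR'.of_frame fun c hc => ?_, hE'.of_frame fun c hc hc' => ?_, ?_, ?_, ?_, ?_,
  fun c hc => ?data⟩
  case data =>
    (try simp (disch := first | omega | decide) only [merge_apply_of_le])
    rw [hval, show a * g.N + (p + 1) = a * g.N + p + 1 by omega,
      show g.Bv + (a * g.N + p + 3) = g.Bv + ((a * g.N + p) + 3) by omega]
    exact g.matData_succ sD c hc
  · rw [merge_apply_of_lt (by omega)]; simp (disch := omega) only [Function.update_of_ne]
  · rw [merge_apply_of_lt (by omega)]; simp (disch := omega) only [Function.update_of_ne]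
  · (try simp (disch := first | omega | decide) only [merge_apply_of_lt,
    Function.update_of_ne]); exact s60
  · (try simp (disch := first | omega | decide) only [merge_apply_of_lt,
    Function.update_of_ne]); rw [back 61 (by omega), r61]
  · (try simp (disch := first | omega | decide) only [merge_apply_of_lt, Function.update_self,
    Function.update_of_ne])
  · (try simp (disch := first | omega | decide) only [merge_apply_of_lt,
    Function.update_self]); omega

/-- **One row.** [folklore] -/
theorem matRow_spec (hF : g.Fits W) (hK : 2 ≤ g.K) {a : ℕ} (ha : a < g.N) {m : ℕ → ℕ}
    (hI : g.RowInv a m) : Achieves W O matRow m (g.RowInv (a + 1)) g.Trow := by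
  obtain ⟨hX, hXLx, hV0, hP0, hOK0, hBv, hSv, htop, hNNV, hPwV, hcMV, hKN, hSN, hmLx, hB3, hmb,
    hNNN, h3m, hB3K, hPw1, hS1⟩ := g.facts hF hK
  obtain ⟨hR, hE, r60, r61, hD⟩ := hI
  unfold matRow Trow
  refine Achieves.mono (T := 2 + ((g.N * (g.Tentry + 2) + 1) + (2 + 0))) ?_ (fun _ h => h) (by omega)
  refine Achieves.seqs_cons (R := g.EntryInv a 0) ?_ fun m₁ h₁ => ?_
  · have r6 := hR.r6
    refine achieves_block_of_eq (fun m' hm' => ?_) le_rfl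
    simp (disch := first | omega | decide) only [execOps_cons, execOps_nil, execOp, Operand.write,
      Operand.read, merge_apply_of_lt, update_merge_of_lt, Function.update_of_ne, BinOp.eval_band,
      Nat.and_self, r6] at hm'
    subst hm'
    refine ⟨hR.of_frame fun c hc => ?_, hE.of_frame fun c hc hc' => ?_, ?_, ?_, ?_, ?_,
    fun c hc => ?data⟩
    case data => (try simp (disch := first | omega | decide) only [merge_apply_of_le]); rw [Nat.add_zero]; exact hD c hc
    · rw [merge_apply_of_lt (by omega)]; simp (disch := omega) only [Function.update_of_ne]
    · rw [merge_apply_of_lt (by omega)]; simp (disch := omega) only [Function.update_of_ne]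
    · (try simp (disch := first | omega | decide) only [merge_apply_of_lt,
      Function.update_of_ne]); exact r60
    · (try simp (disch := first | omega | decide) only [merge_apply_of_lt,
      Function.update_of_ne]); exact r61
    · (try simp (disch := first | omega | decide) only [merge_apply_of_lt, Function.update_self,
      Function.update_of_ne])
    · (try simp (disch := first | omega | decide) only [merge_apply_of_lt,
      Function.update_self]); omega
  refine Achieves.seqs_cons (R := g.EntryInv a g.N) ?_ fun m₂ h₂ => ?_
  · refine Achieves.whilenz g.N g.Tentry (fun p => g.EntryInv a p)
      (fun p hp m' hI => ⟨?_,
      g.matEntry_spec hF hK ha hp hI⟩) (fun m' hI => ?_) h₁ (fun _ h => h) le_rfl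
    · simp only [Operand.read, hI.r64]; omega
    · simp only [Operand.read, hI.r64]; omega
  obtain ⟨hR₂, hE₂, s60, s61, -, -, sD⟩ := h₂
  refine Achieves.seqs_cons (T₂ := 0) ?_ (fun _ h => Achieves.seqs_nil h)
  refine achieves_block_of_eq (fun m' hm' => ?_) le_rfl
  simp (disch := first | omega | decide) only [execOps_cons, execOps_nil, execOp, Operand.write,
    Operand.read, merge_apply_of_lt, update_merge_of_lt, Function.update_of_ne,
    BinOp.eval_add_of_lt, BinOp.eval_sub_of_le, s60, s61] at hm'
  subst hm'
  refine ⟨hR₂.of_frame fun c hc => ?_, hE₂.of_frame fun c hc hc' => ?_, ?_, ?_, fun c hc => ?data⟩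
  case data => (try simp (disch := first | omega | decide) only [merge_apply_of_le]); rw [sD c hc,
    show a * g.N + g.N = (a + 1) * g.N by ring]
  · rw [merge_apply_of_lt (by omega)]; simp (disch := omega) only [Function.update_of_ne]
  · rw [merge_apply_of_lt (by omega)]; simp (disch := omega) only [Function.update_of_ne]
  · (try simp (disch := first | omega | decide) only [merge_apply_of_lt, Function.update_self,
    Function.update_of_ne])
  · (try simp (disch := first | omega | decide) only [merge_apply_of_lt,
    Function.update_self]); omega

/-- **The adjacency matrix.** [folklore] -/
theorem matrix_spec (hF : g.Fits W) (hK : 2 ≤ g.K) {m : ℕ → ℕ} (hO : g.OkInv g.N m) :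
    Achieves W O matrix m (g.RowInv g.N) (g.N * (g.Trow + 2) + 3) := by
  obtain ⟨hX, hXLx, hV0, hP0, hOK0, hBv, hSv, htop, hNNV, hPwV, hcMV, hKN, hSN, hmLx, hB3, hmb,
    hNNN, h3m, hB3K, hPw1, hS1⟩ := g.facts hF hK
  obtain ⟨hR, hE, -, -, hD⟩ := hO
  unfold matrix
  refine Achieves.mono (T := 2 + ((g.N * (g.Trow + 2) + 1) + 0)) ?_ (fun _ h => h) (by omega)
  refine Achieves.seqs_cons (R := g.RowInv 0) ?_ fun m₁ h₁ => ?_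
  · have r6 := hR.r6
    refine achieves_block_of_eq (fun m' hm' => ?_) le_rfl
    simp (disch := first | omega | decide) only [execOps_cons, execOps_nil, execOp, Operand.write,
      Operand.read, merge_apply_of_lt, update_merge_of_lt, Function.update_of_ne, BinOp.eval_band,
      Nat.and_self, r6] at hm'
    subst hm'
    refine ⟨hR.of_frame fun c hc => ?_, hE.of_frame fun c hc hc' => ?_, ?_, ?_, fun c hc => ?data⟩
    case data => (try simp (disch := first | omega | decide) only [merge_apply_of_le]); rw [hD c hc, Nat.zero_mul, g.matData_zero]
    · rw [merge_apply_of_lt (by omega)]; simp (disch := omega) only [Function.update_of_ne]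
    · rw [merge_apply_of_lt (by omega)]; simp (disch := omega) only [Function.update_of_ne]
    · (try simp (disch := first | omega | decide) only [merge_apply_of_lt, Function.update_self,
      Function.update_of_ne])
    · (try simp (disch := first | omega | decide) only [merge_apply_of_lt,
      Function.update_self]); omega
  refine Achieves.seqs_cons ?_ (fun _ h => Achieves.seqs_nil h)
  refine Achieves.whilenz g.N g.Trow (fun a => g.RowInv a)
    (fun a ha m' hI => ⟨?_, g.matRow_spec hF hK ha hI⟩) (fun m' hI => ?_) h₁ (fun _ h => h) le_rfl
  · simp only [Operand.read, hI.r61]; omega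
  · simp only [Operand.read, hI.r61]; omega

end Params

end CliqueRed

end Literature.Computability.FineGrained

namespace Literature.Computability.FineGrained

open Cryptography Cryptography.WordRAM Complexity Cryptography.WordRAM.SProg

namespace CliqueRed

/-- Clearing a list of registers. [folklore] -/
theorem execOps_clear (W : ℕ) (l : List ℕ) : ∀ (m : ℕ → ℕ),
    execOps W m (l.map fun i => ((.band, r i, im 0, im 0) : OpSpec)) =
      fun a => if a ∈ l then 0 else m a := by
  induction l with
  | nil => intro m; funext a; simp
  | cons i l ih =>
    intro m; funext a
    rw [List.map_cons, execOps_cons, ih]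
    by_cases h : a ∈ l
    · simp [h]
    · by_cases h' : a = i
      · subst h'; simp [execOp, Operand.write, h]
      · simp [execOp, Operand.write, h, h']

/-- Membership in the cleared registers. [folklore] -/
theorem mem_clearedRegs (a : ℕ) : a ∈ clearedRegs ↔ a < 100 ∧ ¬ (10 ≤ a ∧ a ≤ 13) := by
  simp [clearedRegs]; omega

/-- `clearedRegs` has `96` elements. [folklore] -/
theorem length_clearedRegs : clearedRegs.length = 96 := by decide

namespace Params

variable (g : Params) {W : ℕ} {O : List ℕ → List ℕ}

/-! ### The cells of the emulated input -/

/-- Emulated cell `0`: the length `N² + 2`. [folklore] -/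
theorem ycell_zero : g.ycell 0 = (g.N * g.N + 2) % g.Pw := rfl

/-- Emulated cell `1`: `K`. [folklore] -/
theorem ycell_one : g.ycell 1 = g.K % g.Pw := by
  unfold ycell y; rw [if_neg one_ne_zero, List.getD_eq_getElem?_getD,
    kClique_encode_posInstance_getElem?_zero]; rfl

/-- Emulated cell `2`: `N`. [folklore] -/
theorem ycell_two : g.ycell 2 = g.N % g.Pw := by
  unfold ycell y; rw [if_neg (by norm_num), List.getD_eq_getElem?_getD,
    kClique_encode_posInstance_getElem?_one]; rfl

/-- Emulated cell `q + 3`, `q < N²`: the adjacency bit of `(q / N, q % N)`. [folklore] -/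
theorem ycell_entry {q : ℕ} (hq : q < g.N * g.N) : g.ycell (q + 3) = g.adjVal (q / g.N) (q % g.N) := by
  have hN : 0 < g.N := Nat.pos_of_ne_zero fun h => by rw [h] at hq; simp at hq
  have ha : q / g.N < g.N := Nat.div_lt_of_lt_mul hq
  have ha' : q % g.N < g.N := Nat.mod_lt _ hN
  have := kClique_encode_posInstance_getElem?_entry g.φ g.K (a := q / g.N) (a' := q % g.N)
    (g.N_eq ▸ ha) (g.N_eq ▸ ha')
  rw [← g.N_eq, Nat.div_add_mod' q g.N] at this
  unfold ycell y adjVal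
  rw [if_neg (by omega), List.getD_eq_getElem?_getD, show q + 3 - 1 = 2 + q by omega, this]
  rfl

/-- **The header written**: from the end of the matrix, the three header cells make the data
final. [folklore] -/
theorem finData_header {m : ℕ → ℕ} (hm : ∀ a, 100 ≤ a → m a = g.matData (g.N * g.N) a) (a : ℕ)
    (ha : 100 ≤ a) :
    Function.update (Function.update (Function.update m g.Bv ((g.N * g.N + 2) % g.Pw))
      (g.Bv + 1) (g.K % g.Pw)) (g.Bv + 2) (g.N % g.Pw) a = g.finData a := by
  obtain ⟨hX, hV0, hP0, hOK0, hBv, -⟩ := g.bases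
  unfold finData
  by_cases h2 : a = g.Bv + 2
  · subst h2; rw [Function.update_self, if_neg (by omega), if_neg (by omega), if_neg (by omega),
      if_neg (by omega), if_pos (by omega), Nat.add_sub_cancel_left, ycell_two]
  rw [Function.update_of_ne h2]
  by_cases h1 : a = g.Bv + 1
  · subst h1; rw [Function.update_self, if_neg (by omega), if_neg (by omega), if_neg (by omega),
      if_neg (by omega), if_pos (by omega), Nat.add_sub_cancel_left, ycell_one]
  rw [Function.update_of_ne h1]
  by_cases h0 : a = g.Bv
  · subst h0; rw [Function.update_self, if_neg (by omega), if_neg (by omega), if_neg (by omega),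
      if_neg (by omega), if_pos (by omega), Nat.sub_self, ycell_zero]
  rw [Function.update_of_ne h0, hm a ha]
  unfold matData
  by_cases h3 : a < g.V0
  · rw [if_pos h3, if_pos h3]
  rw [if_neg h3, if_neg h3]
  by_cases h4 : a < g.P0
  · rw [if_pos h4, if_pos h4]
  rw [if_neg h4, if_neg h4]
  by_cases h5 : a < g.OK0
  · rw [if_pos h5, if_pos h5]
  rw [if_neg h5, if_neg h5]
  by_cases h6 : a < g.Bv
  · rw [if_pos h6, if_pos h6]
  rw [if_neg h6, if_neg h6, if_neg (by omega)]
  by_cases h7 : a - (g.Bv + 3) < g.N * g.N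
  · rw [if_pos h7, if_pos (by omega), show a - g.Bv = (a - (g.Bv + 3)) + 3 by omega,
      g.ycell_entry h7]
  · rw [if_neg h7, if_neg (by omega)]

/-! ### The whole build -/

/-- The time of the build. [folklore] -/
def Tpre : ℕ :=
  7 * g.Lx + 17 + (Nat.size (g.N * g.N + 2) * 4 + 1) + 16 + (g.m * 53 + 4) +
    (g.N * (g.Tok + 2) + 3) + (g.N * (g.Trow + 2) + 3) + 11 + 96

/-- **The build.** On the initial memory of the input `x = encodeCNFWords φ` (word size `W` with
`g.Fits W`, `K ≥ 2`, width `≤ 3`), `pre` ends, within `Tpre` steps, in the closed-form memory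
`finMem`: environment registers `Bv, Sv, 0, Pw`, all other registers `0`, and the data
`finData` (relocated input, slot tables, vertex table, and the emulated `kClique` input).
[folklore] -/
theorem pre_spec (hF : g.Fits W) (hK : 2 ≤ g.K) (hw : g.φ.IsWidthLE 3) :
    Achieves W O (pre g.K g.kM g.cM) (initFun g.x) (fun m => m = g.finMem) g.Tpre := by
  obtain ⟨hX, hXLx, hV0, hP0, hOK0, hBv, hSv, htop, hNNV, hPwV, hcMV, hKN, hSN, hmLx, hB3, hmb,
    hNNN, h3m, hB3K, hPw1, hS1⟩ := g.facts hF hK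
  obtain ⟨-, -, -, -, hLxW⟩ := hF.bounds
  unfold pre Tpre
  refine Achieves.mono (T := 7 * g.Lx + (17 + ((Nat.size (g.N * g.N + 2) * 4 + 1) + (16 +
    ((g.m * 53 + 4) + ((g.N * (g.Tok + 2) + 3) + ((g.N * (g.Trow + 2) + 3) + (11 + (96 + 0)))))))))
    ?_ (fun _ h => h) (by omega)
  -- relocate
  refine Achieves.seqs_cons (R := fun m => m = relocated g.x) (T₁ := 7 * g.Lx)
    (fun qs => ⟨relocated g.x, 7 * g.Lx, le_rfl, ?_, rfl⟩) ?_
  · have h2 := g.two_le_Lx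
    unfold Lx at h2 hLxW
    exact relocate_exec (by omega) hF.input (by omega) qs
  rintro m rfl
  -- setup
  refine Achieves.seqs_cons (g.setup1_spec hF hK) ?_
  rintro m₁ ⟨hR₁, -, h21, h22, hD₁⟩
  refine Achieves.seqs_cons (sizeLoop_spec (O := O) h21 h22 (by omega)) ?_
  rintro m₂ ⟨s22, -, sf⟩
  have hR₂ : g.Regs m₂ := hR₁.of_frame fun a ha => sf a (by omega) (by omega)
  have hD₂ : ∀ a, 100 ≤ a → m₂ a = relocated g.x a := fun a ha => by
    rw [sf a (by omega) (by omega), hD₁ a ha]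
  refine Achieves.seqs_cons (g.setup3_spec hF hK hR₂ s22 hD₂) ?_
  rintro m₃ ⟨hR₃, hE₃, hD₃⟩
  -- tables, vertex table, matrix
  refine Achieves.seqs_cons (g.tables_spec hF hK hw hR₃ hE₃ hD₃) fun m₄ h₄ => ?_
  refine Achieves.seqs_cons (g.okTable_spec hF hK h₄) fun m₅ h₅ => ?_
  refine Achieves.seqs_cons (g.matrix_spec hF hK h₅) fun m₆ h₆ => ?_
  obtain ⟨hR₆, hE₆, -, -, hD₆⟩ := h₆
  -- header
  refine Achieves.seqs_cons (R := fun m₇ => g.Regs m₇ ∧ g.ERegs m₇ ∧ ∀ a,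
  100 ≤ a → m₇ a = g.finData a)
    (T₁ := 11) ?_ ?_
  · obtain ⟨r0, r2, r3, r4, r5, r6, r7, r8, r9, r10⟩ := hR₆
    obtain ⟨r11, r12, r13⟩ := hE₆
    refine achieves_block_of_eq (fun m' hm' => ?_) le_rfl
    simp (disch := first | omega | decide) only [execOps_cons, execOps_nil, execOp, Operand.write,
      Operand.read, merge_apply_of_lt, update_merge_of_lt, update_merge_of_le,
      Function.update_self, Function.update_of_ne, BinOp.eval_add_of_lt, BinOp.eval_mul_of_lt,
      BinOp.eval_mod, BinOp.eval_band, Nat.and_self, r6, r10, r13] at hm'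
    subst hm'
    refine ⟨⟨?_, ?_, ?_, ?_, ?_, ?_, ?_, ?_, ?_, ?_⟩, ⟨?_, ?_, ?_⟩, fun a ha => ?data⟩
    case data => (try simp (disch := first | omega | decide) only [merge_apply_of_le]); exact g.finData_header hD₆ a ha
    all_goals (try simp (disch := first | omega | decide) only [merge_apply_of_lt,
      Function.update_of_ne])
    all_goals assumption
  rintro m₇ ⟨hR₇, hE₇, hD₇⟩
  -- clearing
  refine Achieves.seqs_cons (T₁ := 96) (T₂ := 0) ?_ fun _ h => Achieves.seqs_nil h
  refine Achieves.block ?_ (by rw [List.length_map, length_clearedRegs])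
  show execOps W m₇ (clearedRegs.map fun i => ((.band, r i, im 0, im 0) : OpSpec)) = g.finMem
  rw [execOps_clear]
  funext a
  unfold finMem
  simp only [mem_clearedRegs]
  by_cases ha : a < 100
  · rw [if_pos ha]
    by_cases h10 : a = 10; · subst h10; simp [hR₇.r10]
    by_cases h11 : a = 11; · subst h11; simp [hE₇.r11]
    by_cases h12 : a = 12; · subst h12; simp [hE₇.r12]
    by_cases h13 : a = 13; · subst h13; simp [hE₇.r13]
    rw [if_pos ⟨ha, by omega⟩, if_neg h10, if_neg h11, if_neg h13]
  · rw [if_neg (by omega), if_neg ha, hD₇ a (by omega)]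

end Params

end CliqueRed

end Literature.Computability.FineGrained

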